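import Literature.Barriers.CriticalPhenomena.LaceExpansionXSpaceTwoLongLinesConstants
import HarnessLib

/-!
# Shapes of the middle factor of Hara's two-long-lines estimate (§3.5) at `p_c`: products of the
# alternating kernels `B₁, B₂` between two rungs, their head and tail sums, and the masses of the
# left and right chains — PROVED

Barrier catalogue `Literature/Barriers/CriticalPhenomena/` (D-0021), infrastructure for the
conditional reduction of `Hara2008_twoLongLinesDiagramBoundPc` (`LaceExpansionXSpaceLemma15Diagrams.lean`,
Hara 2008, §3.5), continuing `LaceExpansionXSpaceTwoLongLinesConstants.lean`.

After the two long lines of a term of the Hara–Slade diagram `Ψ^{(0)} B₁B₂⋯B₁ A₃(·,x)`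
(Heydenreich–van der Hofstad (7.4.10)) are erased, the kernels strictly between the two erased
kernels form an ALTERNATING product `U = X_i X_{i+1} ⋯ X_j` of `B₁`'s and `B₂`'s, possibly tied by a
rung `ρ` at either end (the rung of `Ψ^{(0)}`, of `A₃`, or of an erased `B₂⁽¹⁾`). The Cauchy–Schwarz
bound of `LaceExpansionXSpaceMiddleFactor.lean` needs the head sum `pkHead_e U` and the tail sum
`pkTail_e U` of this middle factor; here they are bounded, for the four families of alternating
products (first kernel `B₁` with a rung / `B₂`, last kernel `B₁` with a rung / `B₂`), by a power of
one constant `𝕂 = 2d(S̄ + 1)` times the geometric rate `κ^{m-1}`, `κ = 2Δ̃_{p_c}Δ_{p_c}` (the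
`ℓ^∞ → ℓ^∞` norm of `B₁B₂` and the `ℓ¹ → ℓ¹` norm of `B₂B₁`), `m` the number of units inside:
"In all these cases, we can collect at least `(N-3)` factors of `cλ`". PROVED here (no hypothesis on
`d` beyond `1 ≤ d` where stated; everything in `[0, ∞]`):

* the constant `bigK d = 2d(S̄ + 1)` dominating `1, 2d, Δ_{p_c}, Δ̃_{p_c}, Δ(0), S̄, Σ τ²`, and
  `kap d = 2Δ̃_{p_c}Δ_{p_c}`;
* coordinates as a `Bool` (`crd`, `pkHeadB`, `pkTailB`) and the closing lemmas of the middle factor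
  in that form; the identity kernel `kId`, products of lists `pkProdI` (a monoid homomorphism),
  the alternating lists `altL d b m` (`kFine d n = altL d true (2n+1)`) and their splittings;
* norms: `‖Π (altL true 2i)‖_{∞→∞}, ‖Π (altL false 2i)‖_{1→1} ≤ κ^i`, with a closing rung
  `‖Π(altL true (2i+1))·ρ‖_{∞→∞}, ‖ρ·Π(altL true (2i+1))‖_{1→1} ≤ κ^i Δ̃`; masses of the left chain
  `Σ Ψ^{(0)}Π(altL true 2i) ≤ Δ(0)κ^i` and of the right chain `Σ Π(altL false 2i)A₃(·,x) ≤ κ^iΔ(0)`;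
* the middle factor `midU ρ₁ L ρ₂ = ρ₁·(Π L)·ρ₂` and its HEAD and TAIL bounds for the four families
  (`head_fam_B1B1`, `head_fam_B1B2`, `head_fam_B2B1`, `head_fam_B2B2`, `tail_fam_…`):
  `≤ 𝕂⁶ κ^{m-1}` (or `κ^m`), from the closed diagrams `H0, H1, Hs` of the constants file and the
  row/column mixtures of `B₂`.

## References

* T. Hara, Ann. Probab. 36 (2008) 530–593 (arXiv:math-ph/0504021): §3.5 (Cases 1–2: "the rest
  by `(cλ)^{N-3}`"; "decomposing it into open triangles and a square").
* M. Heydenreich, R. van der Hofstad, *Progress in High-Dimensional Percolation and Random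
  Graphs*, Springer 2017: (7.4.10), (7.5.9)–(7.5.12), Exercise 7.5.
-/

noncomputable section

open scoped ENNReal

namespace Literature.Barriers.CriticalPhenomena

open _root_.MeasureTheory Literature.Probability.LatticeModels Literature.Probability.Percolation

variable {d : ℕ}

/-! ### One constant for all junctions, and the rate -/

/-- The **master constant** `𝕂 := 2d (S̄ + 1)`: it dominates `1`, `2d`, `Δ_{p_c}`, `Δ̃_{p_c}`,
`Δ(0)`, `S̄` and `Σ τ²`, so that every junction constant of the two-long-lines estimate is a power
of `𝕂`. [cite: Hara2008, §3.5 ("bounded by some powers of triangles … and a square")] -/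
def bigK (d : ℕ) : ℝ≥0∞ := 2 * d * (percSqBar d + 1)

/-- The **rate** `κ := 2 Δ̃_{p_c} Δ_{p_c}` (`≥ ‖B₁B₂‖_{∞→∞}, ‖B₂B₁‖_{1→1}`).
[cite: HeydenreichVanDerHofstad2017, (7.5.12) and Exercise 7.5] -/
def kap (d : ℕ) : ℝ≥0∞ := 2 * percTriTildeBar d * percTriBar d

/-- `1 ≤ 2d` for `d ≥ 1`. [folklore] -/
theorem one_le_two_mul_d (hd : 1 ≤ d) : (1 : ℝ≥0∞) ≤ 2 * d := by
  have h : (1 : ℝ≥0∞) ≤ d := by exact_mod_cast hd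
  calc (1 : ℝ≥0∞) ≤ d := h
    _ ≤ 2 * d := le_mul_of_one_le_left' one_le_two

/-- `2d ≤ 𝕂`. [folklore] -/
theorem two_mul_d_le_bigK : (2 * d : ℝ≥0∞) ≤ bigK d := by
  unfold bigK; exact le_mul_of_one_le_right' le_add_self

/-- `1 ≤ 𝕂` for `d ≥ 1`. [folklore] -/
theorem one_le_bigK (hd : 1 ≤ d) : 1 ≤ bigK d := (one_le_two_mul_d hd).trans two_mul_d_le_bigK

/-- `2 ≤ 𝕂` for `d ≥ 1`. [folklore] -/
theorem two_le_bigK (hd : 1 ≤ d) : 2 ≤ bigK d := by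
  have h : (1 : ℝ≥0∞) ≤ d := by exact_mod_cast hd
  calc (2 : ℝ≥0∞) = 2 * 1 := (mul_one _).symm
    _ ≤ 2 * d := mul_le_mul' le_rfl h
    _ ≤ bigK d := two_mul_d_le_bigK

/-- `S̄ + 1 ≤ 𝕂` for `d ≥ 1`. [folklore] -/
theorem percSqBar_add_one_le_bigK (hd : 1 ≤ d) : percSqBar d + 1 ≤ bigK d := by
  unfold bigK; exact le_mul_of_one_le_left' (one_le_two_mul_d hd)

/-- `S̄ ≤ 𝕂` for `d ≥ 1`. [folklore] -/
theorem percSqBar_le_bigK (hd : 1 ≤ d) : percSqBar d ≤ bigK d :=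
  le_self_add.trans (percSqBar_add_one_le_bigK hd)

/-- `Δ_{p_c} ≤ 𝕂` for `d ≥ 1`. [folklore] -/
theorem percTriBar_le_bigK (hd : 1 ≤ d) : percTriBar d ≤ bigK d :=
  percTriBar_le_percSqBar.trans (percSqBar_le_bigK hd)

/-- `Δ(x) ≤ 𝕂` for `d ≥ 1`. [folklore] -/
theorem percTri_le_bigK (hd : 1 ≤ d) (x : Site d) : percTri d x ≤ bigK d :=
  (le_iSup (percTri d) x).trans (percTriBar_le_bigK hd)

/-- `(τ⋆τ)(x) ≤ 𝕂` for `d ≥ 1` (in particular `Σ_y τ(y)² = (τ⋆τ)(0) ≤ 𝕂`). [folklore] -/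
theorem percBubble_le_bigK (hd : 1 ≤ d) (x : Site d) : percBubble d x ≤ bigK d :=
  (percBubble_le_percTriBar x).trans (percTriBar_le_bigK hd)

/-- `Δ̃_{p_c} ≤ 2d Δ_{p_c} ≤ 𝕂`. [folklore] -/
theorem percTriTildeBar_le_bigK : percTriTildeBar d ≤ bigK d :=
  calc percTriTildeBar d ≤ 2 * d * percTriBar d := percTriTildeBar_le
    _ ≤ 2 * d * (percSqBar d + 1) := mul_le_mul' le_rfl (percTriBar_le_percSqBar.trans le_self_add)

/-- Powers of `𝕂` are monotone in the exponent (`d ≥ 1`). [folklore] -/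
theorem bigK_pow_mono (hd : 1 ≤ d) {a b : ℕ} (h : a ≤ b) : bigK d ^ a ≤ bigK d ^ b :=
  pow_le_pow_right₀ (one_le_bigK hd) h

/-- `x ≤ 𝕂^a` and `a ≤ b` give `x ≤ 𝕂^b`. [folklore] -/
theorem le_bigK_pow_of_le (hd : 1 ≤ d) {x : ℝ≥0∞} {a b : ℕ} (hx : x ≤ bigK d ^ a) (h : a ≤ b) :
    x ≤ bigK d ^ b :=
  hx.trans (bigK_pow_mono hd h)

/-- A product of two powers of `𝕂`-bounded quantities. [folklore] -/
theorem mul_le_bigK_pow {x y : ℝ≥0∞} {a b : ℕ} (hx : x ≤ bigK d ^ a) (hy : y ≤ bigK d ^ b) :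
    x * y ≤ bigK d ^ (a + b) := by
  rw [pow_add]; exact mul_le_mul' hx hy

/-- `x ≤ 𝕂` and `1 ≤ b` give `x ≤ 𝕂^b`. [folklore] -/
theorem le_bigK_pow_of_le_bigK (hd : 1 ≤ d) {x : ℝ≥0∞} {b : ℕ} (hx : x ≤ bigK d) (hb : 1 ≤ b) :
    x ≤ bigK d ^ b :=
  hx.trans (by simpa using bigK_pow_mono hd hb)

/-- `𝕂 ≤ 𝕂^b` for `1 ≤ b`. [folklore] -/
theorem self_le_bigK_pow (hd : 1 ≤ d) {b : ℕ} (hb : 1 ≤ b) : bigK d ≤ bigK d ^ b :=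
  le_bigK_pow_of_le_bigK hd le_rfl hb

/-- `‖B₁B₂‖_{∞→∞} ≤ κ`. [cite: HeydenreichVanDerHofstad2017, (7.5.12)] -/
theorem pkNormInf_kB1_kB2_le_kap : pkNormInf (pkMul (kB1 d) (kB2 d)) ≤ kap d := pkNormInf_kB1_kB2_le

/-- `‖B₂B₁‖_{1→1} ≤ κ`. [cite: HeydenreichVanDerHofstad2017, Exercise 7.5] -/
theorem pkNormOne_kB2_kB1_le_kap : pkNormOne (pkMul (kB2 d) (kB1 d)) ≤ kap d := pkNormOne_kB2_kB1_le

/-! ### Coordinates as a `Bool` -/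

section BoolCoord

variable {α : Type*}

/-- The coordinate `crd true = fst`, `crd false = snd` of a pair. [folklore] -/
def crd : Bool → α × α → α
  | true, p => p.1
  | false, p => p.2

/-- `crd true p = p.1`. [folklore] -/
@[simp] theorem crd_true (p : α × α) : crd true p = p.1 := rfl

/-- `crd false p = p.2`. [folklore] -/
@[simp] theorem crd_false (p : α × α) : crd false p = p.2 := rfl

/-- The head sum entered on coordinate `e`. [cite: Hara2008, §3.5 (Case 2)] -/
def pkHeadB : Bool → (α × α → α × α → ℝ≥0∞) → ℝ≥0∞
  | true, X => pkHead1 X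
  | false, X => pkHead2 X

/-- The tail sum exited from coordinate `e`. [cite: Hara2008, §3.5 (Case 2)] -/
def pkTailB : Bool → (α × α → α × α → ℝ≥0∞) → ℝ≥0∞
  | true, X => pkTail1 X
  | false, X => pkTail2 X

/-- `pkHeadB true = pkHead1`. [folklore] -/
@[simp] theorem pkHeadB_true (X : α × α → α × α → ℝ≥0∞) : pkHeadB true X = pkHead1 X := rfl

/-- `pkHeadB false = pkHead2`. [folklore] -/
@[simp] theorem pkHeadB_false (X : α × α → α × α → ℝ≥0∞) : pkHeadB false X = pkHead2 X := rfl

/-- `pkTailB true = pkTail1`. [folklore] -/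
@[simp] theorem pkTailB_true (X : α × α → α × α → ℝ≥0∞) : pkTailB true X = pkTail1 X := rfl

/-- `pkTailB false = pkTail2`. [folklore] -/
@[simp] theorem pkTailB_false (X : α × α → α × α → ℝ≥0∞) : pkTailB false X = pkTail2 X := rfl

/-- Monotonicity of `pkHeadB`. [folklore] -/
theorem pkHeadB_mono (e : Bool) {X Y : α × α → α × α → ℝ≥0∞} (h : ∀ p q, X p q ≤ Y p q) :
    pkHeadB e X ≤ pkHeadB e Y := by
  cases e
  · exact pkHead2_mono h
  · exact pkHead1_mono h

/-- Monotonicity of `pkTailB`. [folklore] -/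
theorem pkTailB_mono (e : Bool) {X Y : α × α → α × α → ℝ≥0∞} (h : ∀ p q, X p q ≤ Y p q) :
    pkTailB e X ≤ pkTailB e Y := by
  cases e
  · exact pkTail2_mono h
  · exact pkTail1_mono h

/-- Subadditivity of `pkHeadB`. [folklore] -/
theorem pkHeadB_add_le (e : Bool) (X Y : α × α → α × α → ℝ≥0∞) :
    pkHeadB e (fun p q => X p q + Y p q) ≤ pkHeadB e X + pkHeadB e Y := by
  cases e
  · exact pkHead2_add_le X Y
  · exact pkHead1_add_le X Y

/-- Subadditivity of `pkTailB`. [folklore] -/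
theorem pkTailB_add_le (e : Bool) (X Y : α × α → α × α → ℝ≥0∞) :
    pkTailB e (fun p q => X p q + Y p q) ≤ pkTailB e X + pkTailB e Y := by
  cases e
  · exact pkTail2_add_le X Y
  · exact pkTail1_add_le X Y

/-- Constants come out of `pkHeadB`. [folklore] -/
theorem pkHeadB_const_mul (e : Bool) (c : ℝ≥0∞) (X : α × α → α × α → ℝ≥0∞) :
    pkHeadB e (fun p q => c * X p q) = c * pkHeadB e X := by
  cases e
  · exact pkHead2_const_mul c X
  · exact pkHead1_const_mul c X

/-- Constants come out of `pkTailB`. [folklore] -/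
theorem pkTailB_const_mul (e : Bool) (c : ℝ≥0∞) (X : α × α → α × α → ℝ≥0∞) :
    pkTailB e (fun p q => c * X p q) = c * pkTailB e X := by
  cases e
  · exact pkTail2_const_mul c X
  · exact pkTail1_const_mul c X

/-- Propagation: `pkHeadB e (XY) ≤ pkHeadB e X · ‖Y‖_{∞→∞}`. [cite: Hara2008, §3.5 (Case 2)] -/
theorem pkHeadB_pkMul_le (e : Bool) (X Y : α × α → α × α → ℝ≥0∞) :
    pkHeadB e (pkMul X Y) ≤ pkHeadB e X * pkNormInf Y := by
  cases e
  · exact pkHead2_pkMul_le X Y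
  · exact pkHead1_pkMul_le X Y

/-- Propagation: `pkTailB e (XY) ≤ ‖X‖_{1→1} · pkTailB e Y`. [cite: Hara2008, §3.5 (Case 2)] -/
theorem pkTailB_pkMul_le (e : Bool) (X Y : α × α → α × α → ℝ≥0∞) :
    pkTailB e (pkMul X Y) ≤ pkNormOne X * pkTailB e Y := by
  cases e
  · exact pkTail2_pkMul_le X Y
  · exact pkTail1_pkMul_le X Y

/-- A `≤ c X`-bounded kernel has `pkHeadB ≤ c · pkHeadB X`. [folklore] -/
theorem pkHeadB_le_of_le_const_mul (e : Bool) {X Y : α × α → α × α → ℝ≥0∞} {c : ℝ≥0∞}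
    (h : ∀ p q, X p q ≤ c * Y p q) : pkHeadB e X ≤ c * pkHeadB e Y := by
  rw [← pkHeadB_const_mul]; exact pkHeadB_mono e h

/-- A `≤ c X`-bounded kernel has `pkTailB ≤ c · pkTailB X`. [folklore] -/
theorem pkTailB_le_of_le_const_mul (e : Bool) {X Y : α × α → α × α → ℝ≥0∞} {c : ℝ≥0∞}
    (h : ∀ p q, X p q ≤ c * Y p q) : pkTailB e X ≤ c * pkTailB e Y := by
  rw [← pkTailB_const_mul]; exact pkTailB_mono e h

/-- **The entry closes on the head sum** (coordinate `e`): `F(P) ≤ f(P_e) · c` gives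
`Σ_P F(P)² row(U)(P) ≤ c² (Σ f²) pkHeadB e U`. [cite: Hara2008, §3.5 (Case 2)] -/
theorem tsum_sq_mul_pkRow_le_pkHeadB (e : Bool) {F : α × α → ℝ≥0∞} {f : α → ℝ≥0∞} {c : ℝ≥0∞}
    (U : α × α → α × α → ℝ≥0∞) (hF : ∀ P, F P ≤ f (crd e P) * c) :
    ∑' P, F P ^ 2 * pkRow U P ≤ c ^ 2 * (∑' a, f a ^ 2) * pkHeadB e U := by
  cases e
  · exact tsum_sq_mul_pkRow_le_pkHead2 U hF
  · exact tsum_sq_mul_pkRow_le_pkHead1 U hF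

/-- **The exit closes on the tail sum** (coordinate `e`): `G(Q) ≤ g(Q_e) · c` gives
`Σ_Q col(U)(Q) G(Q)² ≤ c² (Σ g²) pkTailB e U`. [cite: Hara2008, §3.5 (Case 2)] -/
theorem tsum_pkCol_mul_sq_le_pkTailB (e : Bool) {G : α × α → ℝ≥0∞} {g : α → ℝ≥0∞} {c : ℝ≥0∞}
    (U : α × α → α × α → ℝ≥0∞) (hG : ∀ Q, G Q ≤ g (crd e Q) * c) :
    ∑' Q, pkCol U Q * G Q ^ 2 ≤ c ^ 2 * (∑' a, g a ^ 2) * pkTailB e U := by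
  cases e
  · exact tsum_pkCol_mul_sq_le_pkTail2 U hG
  · exact tsum_pkCol_mul_sq_le_pkTail1 U hG

end BoolCoord

/-! ### The identity kernel and products of lists of kernels -/

section ProdI

variable {α : Type*} [DecidableEq α]

/-- The identity kernel `δ_{p,q}`. [folklore] -/
def kId : α × α → α × α → ℝ≥0∞ := fun p q => if p = q then 1 else 0

/-- `X · Id = X`. [folklore] -/
@[simp] theorem pkMul_kId (X : α × α → α × α → ℝ≥0∞) : pkMul X kId = X := by
  funext p q
  rw [pkMul, tsum_eq_single q]
  · simp [kId]
  · intro p' hp'; simp [kId, hp']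

/-- `Id · X = X`. [folklore] -/
@[simp] theorem kId_pkMul (X : α × α → α × α → ℝ≥0∞) : pkMul kId X = X := by
  funext p q
  rw [pkMul, tsum_eq_single p]
  · simp [kId]
  · intro p' hp'; simp [kId, Ne.symm hp']

/-- `v · Id = v`. [folklore] -/
@[simp] theorem pkVmul_kId (v : α × α → ℝ≥0∞) : pkVmul v kId = v := by
  funext q
  rw [pkVmul, tsum_eq_single q]
  · simp [kId]
  · intro p hp; simp [kId, hp]

/-- `Id · f = f`. [folklore] -/
@[simp] theorem pkKvec_kId (f : α × α → ℝ≥0∞) : pkKvec kId f = f := by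
  funext p
  rw [pkKvec, tsum_eq_single p]
  · simp [kId]
  · intro q hq; simp [kId, Ne.symm hq]

/-- `‖Id‖_{∞→∞} ≤ 1`. [folklore] -/
theorem pkNormInf_kId_le : pkNormInf (kId : α × α → α × α → ℝ≥0∞) ≤ 1 := by
  refine iSup_le fun p => ?_
  rw [tsum_eq_single p]
  · simp [kId]
  · intro q hq; simp [kId, Ne.symm hq]

/-- `‖Id‖_{1→1} ≤ 1`. [folklore] -/
theorem pkNormOne_kId_le : pkNormOne (kId : α × α → α × α → ℝ≥0∞) ≤ 1 := by
  refine iSup_le fun q => ?_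
  rw [tsum_eq_single q]
  · simp [kId]
  · intro p hp; simp [kId, hp]

/-- The product `X₁ X₂ ⋯ X_m` of a list of kernels (`Id` for the empty list). [folklore] -/
def pkProdI : List (α × α → α × α → ℝ≥0∞) → α × α → α × α → ℝ≥0∞
  | [] => kId
  | M :: Ms => pkMul M (pkProdI Ms)

/-- Unfolding on `nil`. [folklore] -/
@[simp] theorem pkProdI_nil : pkProdI ([] : List (α × α → α × α → ℝ≥0∞)) = kId := rfl

/-- Unfolding on `cons`. [folklore] -/
@[simp] theorem pkProdI_cons (M : α × α → α × α → ℝ≥0∞) (Ms : List (α × α → α × α → ℝ≥0∞)) :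
    pkProdI (M :: Ms) = pkMul M (pkProdI Ms) := rfl

/-- `Π [M] = M`. [folklore] -/
theorem pkProdI_singleton (M : α × α → α × α → ℝ≥0∞) : pkProdI [M] = M := by simp

/-- `Π (L ++ L') = Π L · Π L'`. [folklore] -/
theorem pkProdI_append (L L' : List (α × α → α × α → ℝ≥0∞)) :
    pkProdI (L ++ L') = pkMul (pkProdI L) (pkProdI L') := by
  induction L with
  | nil => simp
  | cons M L ih => rw [List.cons_append, pkProdI_cons, pkProdI_cons, ih, pkMul_assoc]

/-- `pkProd M Ms = Π (M :: Ms)`. [folklore] -/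
theorem pkProd_eq_pkProdI (M : α × α → α × α → ℝ≥0∞) (Ms : List (α × α → α × α → ℝ≥0∞)) :
    pkProd M Ms = pkProdI (M :: Ms) := by
  induction Ms generalizing M with
  | nil => simp
  | cons M' Ms ih => rw [pkProd_cons, ih]; rfl

/-- `‖Π L‖_{∞→∞} ≤ Π ‖X‖_{∞→∞}`. [cite: HeydenreichVanDerHofstad2017, (7.5.9)–(7.5.11)] -/
theorem pkNormInf_pkProdI_le (L : List (α × α → α × α → ℝ≥0∞)) :
    pkNormInf (pkProdI L) ≤ (L.map pkNormInf).prod := by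
  induction L with
  | nil => simpa using pkNormInf_kId_le
  | cons M L ih =>
    rw [pkProdI_cons, List.map_cons, List.prod_cons]
    exact (pkNormInf_pkMul_le _ _).trans (mul_le_mul' le_rfl ih)

/-- `‖Π L‖_{1→1} ≤ Π ‖X‖_{1→1}`. [cite: HeydenreichVanDerHofstad2017, Exercise 7.5] -/
theorem pkNormOne_pkProdI_le (L : List (α × α → α × α → ℝ≥0∞)) :
    pkNormOne (pkProdI L) ≤ (L.map pkNormOne).prod := by
  induction L with
  | nil => simpa using pkNormOne_kId_le
  | cons M L ih =>
    rw [pkProdI_cons, List.map_cons, List.prod_cons]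
    exact (pkNormOne_pkMul_le _ _).trans (mul_le_mul' le_rfl ih)

/-- A right chain is the product of its kernels applied to the end vector. [folklore] -/
theorem pkChainR_eq_pkKvec_pkProdI (L : List (α × α → α × α → ℝ≥0∞)) (f : α × α → ℝ≥0∞) :
    pkChainR L f = pkKvec (pkProdI L) f := by
  induction L with
  | nil => simp
  | cons M L ih => rw [pkChainR_cons, ih, pkKvec_pkKvec, pkProdI_cons]

/-- A left chain is the row vector applied to the product of its kernels. [folklore] -/
theorem pkChainL_eq_pkVmul_pkProdI (v : α × α → ℝ≥0∞) (L : List (α × α → α × α → ℝ≥0∞)) :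
    pkChainL v L = pkVmul v (pkProdI L) := by
  induction L generalizing v with
  | nil => simp
  | cons M L ih => rw [pkChainL_cons, ih, pkVmul_pkVmul, pkProdI_cons]

/-- `Σ_q (L f)(q) ≤ (Π ‖X‖_{1→1}) Σ f` through `pkProdI`. [cite: HeydenreichVanDerHofstad2017, Exercise 7.5] -/
theorem tsum_pkKvec_pkProdI_le (L : List (α × α → α × α → ℝ≥0∞)) (f : α × α → ℝ≥0∞) :
    ∑' q, pkKvec (pkProdI L) f q ≤ (L.map pkNormOne).prod * ∑' q, f q := by
  rw [← pkChainR_eq_pkKvec_pkProdI]; exact tsum_pkChainR_le L f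

/-- `Σ_p (v Π L)(p) ≤ (Σ v) Π ‖X‖_{∞→∞}` through `pkProdI`. [cite: HeydenreichVanDerHofstad2017, (7.5.9)] -/
theorem tsum_pkVmul_pkProdI_le (v : α × α → ℝ≥0∞) (L : List (α × α → α × α → ℝ≥0∞)) :
    ∑' p, pkVmul v (pkProdI L) p ≤ (∑' p, v p) * (L.map pkNormInf).prod := by
  rw [← pkChainL_eq_pkVmul_pkProdI]; exact tsum_pkChainL_le v L

/-- **The middle factor between two rungs**: `midU ρ₁ L ρ₂ = ρ₁ · (Π L) · ρ₂`. [cite: Hara2008, §3.5 (Case 2)] -/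
def midU (ρ₁ : α × α → ℝ≥0∞) (L : List (α × α → α × α → ℝ≥0∞)) (ρ₂ : α × α → ℝ≥0∞) :
    α × α → α × α → ℝ≥0∞ :=
  pkScaleR (pkScaleL ρ₁ (pkProdI L)) ρ₂

/-- Unfolding of `midU`. [folklore] -/
theorem midU_apply (ρ₁ : α × α → ℝ≥0∞) (L : List (α × α → α × α → ℝ≥0∞)) (ρ₂ : α × α → ℝ≥0∞)
    (p q : α × α) : midU ρ₁ L ρ₂ p q = ρ₁ p * pkProdI L p q * ρ₂ q := rfl

/-- `midU ρ₁ (M :: L) ρ₂ = (ρ₁·M) · ((Π L)·ρ₂)`. [folklore] -/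
theorem midU_cons (ρ₁ : α × α → ℝ≥0∞) (M : α × α → α × α → ℝ≥0∞)
    (L : List (α × α → α × α → ℝ≥0∞)) (ρ₂ : α × α → ℝ≥0∞) :
    midU ρ₁ (M :: L) ρ₂ = pkMul (pkScaleL ρ₁ M) (pkScaleR (pkProdI L) ρ₂) := by
  rw [midU, pkProdI_cons, pkScaleL_pkMul, pkScaleR_pkMul]

/-- `midU ρ₁ (L ++ [M]) ρ₂ = (ρ₁·(Π L)) · (M·ρ₂)`. [folklore] -/
theorem midU_append_singleton (ρ₁ : α × α → ℝ≥0∞) (L : List (α × α → α × α → ℝ≥0∞))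
    (M : α × α → α × α → ℝ≥0∞) (ρ₂ : α × α → ℝ≥0∞) :
    midU ρ₁ (L ++ [M]) ρ₂ = pkMul (pkScaleL ρ₁ (pkProdI L)) (pkScaleR M ρ₂) := by
  rw [midU, pkProdI_append, pkProdI_singleton, pkScaleL_pkMul, pkScaleR_pkMul]

/-- `midU ρ₁ (L ++ M :: L') ρ₂ = (ρ₁·(Π L)) · M · ((Π L')·ρ₂)`. [folklore] -/
theorem midU_append_cons (ρ₁ : α × α → ℝ≥0∞) (L : List (α × α → α × α → ℝ≥0∞))
    (M : α × α → α × α → ℝ≥0∞) (L' : List (α × α → α × α → ℝ≥0∞)) (ρ₂ : α × α → ℝ≥0∞) :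
    midU ρ₁ (L ++ M :: L') ρ₂ = pkMul (pkMul (pkScaleL ρ₁ (pkProdI L)) M) (pkScaleR (pkProdI L') ρ₂) := by
  rw [midU, pkProdI_append, pkProdI_cons, pkScaleL_pkMul, ← pkMul_assoc, pkScaleR_pkMul]

/-- Monotonicity of `midU` in the right rung. [folklore] -/
theorem midU_mono_right (ρ₁ : α × α → ℝ≥0∞) (L : List (α × α → α × α → ℝ≥0∞))
    {ρ₂ ρ₂' : α × α → ℝ≥0∞} (h : ∀ q, ρ₂ q ≤ ρ₂' q) (p q : α × α) :
    midU ρ₁ L ρ₂ p q ≤ midU ρ₁ L ρ₂' p q :=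
  mul_le_mul' le_rfl (h q)

/-- Monotonicity of `midU` in the left rung. [folklore] -/
theorem midU_mono_left {ρ₁ ρ₁' : α × α → ℝ≥0∞} (h : ∀ p, ρ₁ p ≤ ρ₁' p)
    (L : List (α × α → α × α → ℝ≥0∞)) (ρ₂ : α × α → ℝ≥0∞) (p q : α × α) :
    midU ρ₁ L ρ₂ p q ≤ midU ρ₁' L ρ₂ p q :=
  mul_le_mul' (mul_le_mul' (h p) le_rfl) le_rfl

omit [DecidableEq α] in
/-- `‖X·ρ‖_{∞→∞} ≤ ‖X‖_{∞→∞}` for `ρ ≤ 1`. [folklore] -/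
theorem pkNormInf_pkScaleR_le_of_le_one {ρ : α × α → ℝ≥0∞} (hρ : ∀ q, ρ q ≤ 1)
    (X : α × α → α × α → ℝ≥0∞) : pkNormInf (pkScaleR X ρ) ≤ pkNormInf X := by
  simpa using pkNormInf_pkScaleR_le hρ X

omit [DecidableEq α] in
/-- `‖ρ·X‖_{1→1} ≤ ‖X‖_{1→1}` for `ρ ≤ 1`. [folklore] -/
theorem pkNormOne_pkScaleL_le_of_le_one {ρ : α × α → ℝ≥0∞} (hρ : ∀ p, ρ p ≤ 1)
    (X : α × α → α × α → ℝ≥0∞) : pkNormOne (pkScaleL ρ X) ≤ pkNormOne X := by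
  simpa using pkNormOne_pkScaleL_le hρ X

/-- `(X·ρ) Y ·` as scaling of a product on the right factor: `Π(L)·ρ` with `L = L' ++ [M]`. [folklore] -/
theorem pkScaleR_pkProdI_append_singleton (L : List (α × α → α × α → ℝ≥0∞))
    (M : α × α → α × α → ℝ≥0∞) (ρ : α × α → ℝ≥0∞) :
    pkScaleR (pkProdI (L ++ [M])) ρ = pkMul (pkProdI L) (pkScaleR M ρ) := by
  rw [pkProdI_append, pkProdI_singleton, pkScaleR_pkMul]

end ProdI

/-! ### The rung, the alternating lists and their norms -/

/-- The rung `ρ(m) = τ(m.2 - m.1)` of a pair. [cite: HeydenreichVanDerHofstad2017, (7.4.4)] -/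
def rho (d : ℕ) (m : Site d × Site d) : ℝ≥0∞ := tauPcE d (m.2 - m.1)

/-- Unfolding of `rho`. [folklore] -/
@[simp] theorem rho_apply (m : Site d × Site d) : rho d m = tauPcE d (m.2 - m.1) := rfl

/-- `ρ ≤ 1`. [folklore] -/
theorem rho_le_one (m : Site d × Site d) : rho d m ≤ 1 := tauPcE_le_one _

/-- `ρ_0 = ρ`. [folklore] -/
theorem oRung_zero_eq_rho : oRung d 0 = rho d := by
  funext m; rw [oRung_zero, rho_apply]

/-- `kRungL Y = ρ·Y`. [folklore] -/
theorem kRungL_eq_pkScaleL (Y : Site d × Site d → Site d × Site d → ℝ≥0∞) : kRungL Y = pkScaleL (rho d) Y := rfl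

/-- `kRungR X = X·ρ`. [folklore] -/
theorem kRungR_eq_pkScaleR (X : Site d × Site d → Site d × Site d → ℝ≥0∞) : kRungR X = pkScaleR X (rho d) := rfl

/-- The constant-one weight. [folklore] -/
theorem one_le_one_pair (q : Site d × Site d) : (fun _ : Site d × Site d => (1 : ℝ≥0∞)) q ≤ 1 := le_rfl

/-- **The alternating list** `altL d b m`: `m` kernels `B₁, B₂, B₁, …` (if `b = true`) or
`B₂, B₁, B₂, …` (if `b = false`). [cite: HeydenreichVanDerHofstad2017, (7.4.10)] -/
def altL (d : ℕ) : Bool → ℕ → List (Site d × Site d → Site d × Site d → ℝ≥0∞)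
  | _, 0 => []
  | b, m + 1 => (if b then kB1 d else kB2 d) :: altL d (!b) m

/-- Unfolding on `0`. [folklore] -/
@[simp] theorem altL_zero (b : Bool) : altL d b 0 = [] := by cases b <;> rfl

/-- Unfolding on `m + 1`. [folklore] -/
theorem altL_succ (b : Bool) (m : ℕ) : altL d b (m + 1) = (if b then kB1 d else kB2 d) :: altL d (!b) m := by
  cases b <;> rfl

/-- `altL true (m+1) = B₁ :: altL false m`. [folklore] -/
@[simp] theorem altL_true_succ (m : ℕ) : altL d true (m + 1) = kB1 d :: altL d false m := rfl

/-- `altL false (m+1) = B₂ :: altL true m`. [folklore] -/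
@[simp] theorem altL_false_succ (m : ℕ) : altL d false (m + 1) = kB2 d :: altL d true m := rfl

/-- `|altL b m| = m`. [folklore] -/
@[simp] theorem length_altL (b : Bool) (m : ℕ) : (altL d b m).length = m := by
  induction m generalizing b with
  | zero => simp
  | succ m ih => rw [altL_succ, List.length_cons, ih]

/-- **Splitting an alternating list**: `altL b (j + k) = altL b j ++ altL (b xor odd j) k`. [folklore] -/
theorem altL_add (b : Bool) (j k : ℕ) : altL d b (j + k) = altL d b j ++ altL d (xor b (Nat.bodd j)) k := by
  induction j generalizing b with
  | zero => simp
  | succ j ih =>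
    rw [Nat.add_right_comm, altL_succ, altL_succ, ih (!b), List.cons_append, Nat.bodd_add]
    have h1 : Nat.bodd 1 = true := rfl
    rw [h1]
    cases b <;> cases Nat.bodd j <;> rfl

/-- `altL b (2i + k) = altL b (2i) ++ altL b k`. [folklore] -/
theorem altL_two_mul_add (b : Bool) (i k : ℕ) : altL d b (2 * i + k) = altL d b (2 * i) ++ altL d b k := by
  rw [altL_add, Nat.bodd_mul]
  have h2 : Nat.bodd 2 = false := rfl
  rw [h2, Bool.false_and, Bool.xor_false]

/-- `altL b (2i + 1 + k) = altL b (2i + 1) ++ altL (!b) k`. [folklore] -/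
theorem altL_two_mul_add_one_add (b : Bool) (i k : ℕ) :
    altL d b (2 * i + 1 + k) = altL d b (2 * i + 1) ++ altL d (!b) k := by
  rw [altL_add, Nat.bodd_add, Nat.bodd_mul]
  have h2 : Nat.bodd 2 = false := rfl
  have h1 : Nat.bodd 1 = true := rfl
  rw [h2, h1, Bool.false_and, Bool.false_xor, Bool.xor_true]

/-- `altL true (2i + 2) = altL true (2i) ++ [B₁, B₂]`. [folklore] -/
theorem altL_true_even_snoc (i : ℕ) : altL d true (2 * i + 2) = altL d true (2 * i) ++ [kB1 d, kB2 d] := by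
  rw [altL_two_mul_add]; rfl

/-- `altL false (2i + 2) = altL false (2i) ++ [B₂, B₁]`. [folklore] -/
theorem altL_false_even_snoc (i : ℕ) : altL d false (2 * i + 2) = altL d false (2 * i) ++ [kB2 d, kB1 d] := by
  rw [altL_two_mul_add]; rfl

/-- `altL true (2i + 3) = altL true (2i + 1) ++ [B₂, B₁]`. [folklore] -/
theorem altL_true_odd_snoc (i : ℕ) : altL d true (2 * i + 3) = altL d true (2 * i + 1) ++ [kB2 d, kB1 d] := by
  rw [show 2 * i + 3 = 2 * i + 1 + 2 by ring, altL_two_mul_add_one_add]; rfl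

/-- `altL false (2i + 3) = altL false (2i + 1) ++ [B₁, B₂]`. [folklore] -/
theorem altL_false_odd_snoc (i : ℕ) : altL d false (2 * i + 3) = altL d false (2 * i + 1) ++ [kB1 d, kB2 d] := by
  rw [show 2 * i + 3 = 2 * i + 1 + 2 by ring, altL_two_mul_add_one_add]; rfl

/-- `altL true (2i + 2) = altL true (2i + 1) ++ [B₂]`. [folklore] -/
theorem altL_true_even_add_two (i : ℕ) : altL d true (2 * i + 2) = altL d true (2 * i + 1) ++ [kB2 d] := by
  rw [show 2 * i + 2 = 2 * i + 1 + 1 by ring, altL_two_mul_add_one_add]; rfl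

/-- `altL true (2i + 1) = altL true (2i) ++ [B₁]`. [folklore] -/
theorem altL_true_two_mul_add_one (i : ℕ) : altL d true (2 * i + 1) = altL d true (2 * i) ++ [kB1 d] := by
  rw [altL_two_mul_add]; rfl

/-- `altL false (2i + 1) = altL false (2i) ++ [B₂]`. [folklore] -/
theorem altL_false_two_mul_add_one (i : ℕ) : altL d false (2 * i + 1) = altL d false (2 * i) ++ [kB2 d] := by
  rw [altL_two_mul_add]; rfl

/-- **The fine list of the diagram of `Π^{(n+1)}` is alternating**: `kFine d n = altL true (2n+1)`.
[cite: HeydenreichVanDerHofstad2017, (7.4.10)] -/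
theorem kFine_eq_altL (n : ℕ) : kFine d n = altL d true (2 * n + 1) := by
  rw [kFine]
  induction n with
  | zero => rfl
  | succ n ih =>
    rw [List.replicate_succ, List.flatten_cons, List.append_assoc, ih,
      show 2 * (n + 1) + 1 = (2 * n + 1) + 1 + 1 by ring]
    rfl

/-- `Π (altL true 2i) = (B₁B₂)^i` as a product of units. [folklore] -/
theorem pkProdI_altL_true_even (i : ℕ) :
    pkProdI (altL d true (2 * i)) = pkProdI (List.replicate i (pkMul (kB1 d) (kB2 d))) := by
  induction i with
  | zero => rfl
  | succ i ih =>
    rw [show 2 * (i + 1) = 2 * i + 1 + 1 by ring, altL_true_succ, altL_false_succ, pkProdI_cons,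
      pkProdI_cons, ih, List.replicate_succ, pkProdI_cons, pkMul_assoc]

/-- `Π (altL false 2i) = (B₂B₁)^i` as a product of units. [folklore] -/
theorem pkProdI_altL_false_even (i : ℕ) :
    pkProdI (altL d false (2 * i)) = pkProdI (List.replicate i (pkMul (kB2 d) (kB1 d))) := by
  induction i with
  | zero => rfl
  | succ i ih =>
    rw [show 2 * (i + 1) = 2 * i + 1 + 1 by ring, altL_false_succ, altL_true_succ, pkProdI_cons,
      pkProdI_cons, ih, List.replicate_succ, pkProdI_cons, pkMul_assoc]

/-- **`‖(B₁B₂)^i‖_{∞→∞} ≤ κ^i`.** [cite: HeydenreichVanDerHofstad2017, (7.5.11)–(7.5.12)] -/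
theorem pkNormInf_altL_true_even_le (i : ℕ) : pkNormInf (pkProdI (altL d true (2 * i))) ≤ kap d ^ i := by
  rw [pkProdI_altL_true_even]
  refine (pkNormInf_pkProdI_le _).trans ?_
  rw [List.map_replicate, List.prod_replicate]
  exact pow_le_pow_left' pkNormInf_kB1_kB2_le_kap i

/-- **`‖(B₂B₁)^i‖_{1→1} ≤ κ^i`.** [cite: HeydenreichVanDerHofstad2017, Exercise 7.5] -/
theorem pkNormOne_altL_false_even_le (i : ℕ) : pkNormOne (pkProdI (altL d false (2 * i))) ≤ kap d ^ i := by
  rw [pkProdI_altL_false_even]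
  refine (pkNormOne_pkProdI_le _).trans ?_
  rw [List.map_replicate, List.prod_replicate]
  exact pow_le_pow_left' pkNormOne_kB2_kB1_le_kap i

/-- `‖Π(altL true 2i) · ρ₂‖_{∞→∞} ≤ κ^i` for `ρ₂ ≤ 1`. [folklore] -/
theorem pkNormInf_altL_true_even_pkScaleR_le (i : ℕ) {ρ₂ : Site d × Site d → ℝ≥0∞} (hρ : ∀ q, ρ₂ q ≤ 1) :
    pkNormInf (pkScaleR (pkProdI (altL d true (2 * i))) ρ₂) ≤ kap d ^ i :=
  (pkNormInf_pkScaleR_le_of_le_one hρ _).trans (pkNormInf_altL_true_even_le i)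

/-- `‖ρ₁ · Π(altL false 2i)‖_{1→1} ≤ κ^i` for `ρ₁ ≤ 1`. [folklore] -/
theorem pkNormOne_pkScaleL_altL_false_even_le (i : ℕ) {ρ₁ : Site d × Site d → ℝ≥0∞} (hρ : ∀ p, ρ₁ p ≤ 1) :
    pkNormOne (pkScaleL ρ₁ (pkProdI (altL d false (2 * i)))) ≤ kap d ^ i :=
  (pkNormOne_pkScaleL_le_of_le_one hρ _).trans (pkNormOne_altL_false_even_le i)

/-- `‖B₁·ρ‖_{∞→∞} ≤ Δ̃_{p_c}` (the last `B₁` closed by a rung). [cite: HeydenreichVanDerHofstad2017, (7.5.13)] -/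
theorem pkNormInf_kB1_rho_le : pkNormInf (pkScaleR (kB1 d) (rho d)) ≤ percTriTildeBar d :=
  pkNormInf_kRungR_kB1_le

/-- `‖ρ·B₁‖_{1→1} ≤ Δ̃_{p_c}` (the first `B₁` closed by a rung). [cite: HeydenreichVanDerHofstad2017, Exercise 7.5] -/
theorem pkNormOne_rho_kB1_le : pkNormOne (pkScaleL (rho d) (kB1 d)) ≤ percTriTildeBar d :=
  pkNormOne_kRungL_kB1_le

/-- **`‖Π(altL true (2i+1)) · ρ‖_{∞→∞} ≤ κ^i Δ̃`** (`(B₁B₂)^i B₁ ρ`). [cite: HeydenreichVanDerHofstad2017, (7.5.11)–(7.5.13)] -/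
theorem pkNormInf_altL_true_odd_rho_le (i : ℕ) :
    pkNormInf (pkScaleR (pkProdI (altL d true (2 * i + 1))) (rho d)) ≤ kap d ^ i * percTriTildeBar d := by
  rw [altL_true_two_mul_add_one, pkScaleR_pkProdI_append_singleton]
  exact (pkNormInf_pkMul_le _ _).trans (mul_le_mul' (pkNormInf_altL_true_even_le i) pkNormInf_kB1_rho_le)

/-- **`‖ρ · Π(altL true (2i+1))‖_{1→1} ≤ Δ̃ κ^i`** (`ρ B₁ (B₂B₁)^i`). [cite: HeydenreichVanDerHofstad2017, Exercise 7.5] -/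
theorem pkNormOne_rho_altL_true_odd_le (i : ℕ) :
    pkNormOne (pkScaleL (rho d) (pkProdI (altL d true (2 * i + 1)))) ≤ percTriTildeBar d * kap d ^ i := by
  rw [altL_true_succ, pkProdI_cons, pkScaleL_pkMul]
  exact (pkNormOne_pkMul_le _ _).trans (mul_le_mul' pkNormOne_rho_kB1_le (pkNormOne_altL_false_even_le i))

/-! ### Masses of the left and right chains -/

/-- `Σ_q A₃(q, x) = Δ(0)` for every endpoint `x`. [cite: HeydenreichVanDerHofstad2017, (7.5.7)] -/
theorem tsum_kA3end (x : Site d) : ∑' q, kA3end d q x = percTri d 0 := by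
  rw [← tsum_kA3end_zero (d := d)]
  refine (tsum_pair_shift (fun q => kA3end d q x) x).trans (tsum_congr fun q => ?_)
  have h := pjTI_kA3end (d := d) x q 0
  rw [zero_add] at h
  exact h

/-- **Mass of the left chain**: `Σ_p (Ψ^{(0)} (B₁B₂)^i)(p) ≤ Δ(0) κ^i`.
[cite: HeydenreichVanDerHofstad2017, (7.5.9)–(7.5.12)] -/
theorem tsum_pkChainL_kPsiZero_altL_le (i : ℕ) :
    ∑' p, pkChainL (kPsiZero d) (altL d true (2 * i)) p ≤ percTri d 0 * kap d ^ i := by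
  rw [pkChainL_eq_pkVmul_pkProdI]
  calc ∑' p, pkVmul (kPsiZero d) (pkProdI (altL d true (2 * i))) p
      ≤ (∑' p, kPsiZero d p) * pkNormInf (pkProdI (altL d true (2 * i))) := tsum_pkVmul_le _ _
    _ ≤ percTri d 0 * kap d ^ i := by rw [tsum_kPsiZero]; exact mul_le_mul' le_rfl (pkNormInf_altL_true_even_le i)

/-- **Mass of the left chain closed by a rung**: `Σ_p (Ψ^{(0)} (B₁B₂)^i B₁ ρ)(p) ≤ Δ(0) κ^i Δ̃`.
[cite: HeydenreichVanDerHofstad2017, (7.5.9)–(7.5.13)] -/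
theorem tsum_pkChainL_kPsiZero_altL_rho_le (i : ℕ) :
    ∑' p, pkChainL (kPsiZero d) (altL d true (2 * i) ++ [pkScaleR (kB1 d) (rho d)]) p ≤
      percTri d 0 * kap d ^ i * percTriTildeBar d := by
  rw [pkChainL_eq_pkVmul_pkProdI]
  calc ∑' p, pkVmul (kPsiZero d) (pkProdI (altL d true (2 * i) ++ [pkScaleR (kB1 d) (rho d)])) p
      ≤ (∑' p, kPsiZero d p) * pkNormInf (pkProdI (altL d true (2 * i) ++ [pkScaleR (kB1 d) (rho d)])) :=
        tsum_pkVmul_le _ _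
    _ ≤ percTri d 0 * (kap d ^ i * percTriTildeBar d) := by
        rw [tsum_kPsiZero, pkProdI_append, pkProdI_singleton]
        exact mul_le_mul' le_rfl ((pkNormInf_pkMul_le _ _).trans
          (mul_le_mul' (pkNormInf_altL_true_even_le i) pkNormInf_kB1_rho_le))
    _ = _ := (mul_assoc _ _ _).symm

/-- **Mass of the right chain**: `Σ_q ((B₂B₁)^i A₃(·,x))(q) ≤ κ^i Δ(0)`. [cite: HeydenreichVanDerHofstad2017, Exercise 7.5] -/
theorem tsum_pkChainR_altL_kA3end_le (i : ℕ) (x : Site d) :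
    ∑' q, pkChainR (altL d false (2 * i)) (fun q => kA3end d q x) q ≤ kap d ^ i * percTri d 0 := by
  rw [pkChainR_eq_pkKvec_pkProdI]
  calc ∑' q, pkKvec (pkProdI (altL d false (2 * i))) (fun q => kA3end d q x) q
      ≤ pkNormOne (pkProdI (altL d false (2 * i))) * ∑' q, kA3end d q x := tsum_pkKvec_le _ _
    _ ≤ kap d ^ i * percTri d 0 := by rw [tsum_kA3end]; exact mul_le_mul' (pkNormOne_altL_false_even_le i) le_rfl

/-- **Mass of the right chain opened by a rung**: `Σ_q (ρB₁ (B₂B₁)^i A₃(·,x))(q) ≤ Δ̃ κ^i Δ(0)`.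
[cite: HeydenreichVanDerHofstad2017, Exercise 7.5] -/
theorem tsum_pkChainR_rho_altL_kA3end_le (i : ℕ) (x : Site d) :
    ∑' q, pkChainR (pkScaleL (rho d) (kB1 d) :: altL d false (2 * i)) (fun q => kA3end d q x) q ≤
      percTriTildeBar d * kap d ^ i * percTri d 0 := by
  rw [pkChainR_eq_pkKvec_pkProdI]
  calc ∑' q, pkKvec (pkProdI (pkScaleL (rho d) (kB1 d) :: altL d false (2 * i))) (fun q => kA3end d q x) q
      ≤ pkNormOne (pkProdI (pkScaleL (rho d) (kB1 d) :: altL d false (2 * i))) * ∑' q, kA3end d q x :=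
        tsum_pkKvec_le _ _
    _ ≤ percTriTildeBar d * kap d ^ i * percTri d 0 := by
        rw [tsum_kA3end, pkProdI_cons]
        exact mul_le_mul' ((pkNormOne_pkMul_le _ _).trans
          (mul_le_mul' pkNormOne_rho_kB1_le (pkNormOne_altL_false_even_le i))) le_rfl

/-- The point mass at a pair sums to `1`. [folklore] -/
theorem tsum_ite_pair_eq_one (q₀ : Site d × Site d) :
    ∑' q : Site d × Site d, (if q = q₀ then (1 : ℝ≥0∞) else 0) = 1 := by
  rw [tsum_eq_single q₀]
  · simp
  · intro q hq; simp [hq]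

/-- Mass of a right chain into a point mass: `Σ_q ((B₂B₁)^i δ_{q₀})(q) ≤ κ^i`. [folklore] -/
theorem tsum_pkChainR_altL_point_le (i : ℕ) (q₀ : Site d × Site d) :
    ∑' q, pkChainR (altL d false (2 * i)) (fun q => if q = q₀ then (1 : ℝ≥0∞) else 0) q ≤ kap d ^ i := by
  rw [pkChainR_eq_pkKvec_pkProdI]
  calc ∑' q, pkKvec (pkProdI (altL d false (2 * i))) (fun q => if q = q₀ then (1 : ℝ≥0∞) else 0) q
      ≤ pkNormOne (pkProdI (altL d false (2 * i))) * ∑' q : Site d × Site d, (if q = q₀ then (1 : ℝ≥0∞) else 0) :=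
        tsum_pkKvec_le _ _
    _ ≤ kap d ^ i := by rw [tsum_ite_pair_eq_one, mul_one]; exact pkNormOne_altL_false_even_le i

/-! ### Pointwise comparisons used for the heads and tails -/

/-- `ρ·B₁ ≤ 2d ρ·B₁°` pointwise. [cite: Hara2008, §3.4 (the line 2dp(D ⋆ G))] -/
theorem pkScaleL_rho_kB1_le (p q : Site d × Site d) :
    pkScaleL (rho d) (kB1 d) p q ≤ 2 * d * kRungL (kB1o d) p q := by
  rw [pkScaleL_apply, kRungL, rho_apply, mul_left_comm]
  exact mul_le_mul' le_rfl (kB1_le_kB1o p q)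

/-- `B₁·ρ ≤ 2d B₁°·ρ` pointwise. [cite: Hara2008, §3.4 (the line 2dp(D ⋆ G))] -/
theorem pkScaleR_kB1_rho_le (p q : Site d × Site d) :
    pkScaleR (kB1 d) (rho d) p q ≤ 2 * d * kRungR (kB1o d) p q := by
  rw [pkScaleR_apply, kRungR, rho_apply, ← mul_assoc]
  exact mul_le_mul' (kB1_le_kB1o p q) le_rfl

/-- `B₂⁽²⁾ B₁ ≤ 2d B₂⁽²⁾ B₁°` pointwise. [cite: Hara2008, §3.4] -/
theorem pkMul_kB2two_kB1_le (p q : Site d × Site d) :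
    pkMul (kB2two d) (kB1 d) p q ≤ 2 * d * pkMul (kB2two d) (kB1o d) p q := by
  rw [pkMul, pkMul, ← ENNReal.tsum_mul_left]
  refine ENNReal.tsum_le_tsum fun m => ?_
  rw [mul_left_comm]
  exact mul_le_mul' le_rfl (kB1_le_kB1o m q)

/-- `B₁ B₂⁽²⁾ ≤ 2d B₁° B₂⁽²⁾` pointwise. [cite: Hara2008, §3.4] -/
theorem pkMul_kB1_kB2two_le (p q : Site d × Site d) :
    pkMul (kB1 d) (kB2two d) p q ≤ 2 * d * pkMul (kB1o d) (kB2two d) p q := by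
  rw [pkMul, pkMul, ← ENNReal.tsum_mul_left]
  refine ENNReal.tsum_le_tsum fun m => ?_
  rw [← mul_assoc]
  exact mul_le_mul' (kB1_le_kB1o p m) le_rfl

/-- `B₂⁽¹⁾ ≤ B₂` and `B₂⁽²⁾ ≤ B₂` pointwise, as a splitting of any kernel expression additive in `B₂`:
`B₂ = B₂⁽¹⁾ + B₂⁽²⁾`. [cite: HeydenreichVanDerHofstad2017, (7.4.4)] -/
theorem kB2_apply (p q : Site d × Site d) : kB2 d p q = kB2one d p q + kB2two d p q := by
  rw [kB2_eq_add]

/-! ### Heads of the middle factor -/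

/-- **Head of `ρ B₁ B₂ W`** (families beginning with a rung and `B₁`): for any right rung `ρ₂`,
`pkHeadB e (ρ·(B₁ B₂ Π L')·ρ₂) ≤ 2d (Δ̄ + Δ(0)) S̄ ‖(Π L')·ρ₂‖_{∞→∞}` (row mixture of `B₂`, then the
square `H0`).
[cite: Hara2008, §3.5 (Case 2, (d-2): "a square")] -/
theorem pkHeadB_midU_rho_kB1_kB2_le (e : Bool) (L' : List (Site d × Site d → Site d × Site d → ℝ≥0∞))
    (ρ₂ : Site d × Site d → ℝ≥0∞) :
    pkHeadB e (midU (rho d) (kB1 d :: kB2 d :: L') ρ₂) ≤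
      2 * d * ((percTriBar d + percTri d 0) * percSqBar d) * pkNormInf (pkScaleR (pkProdI L') ρ₂) := by
  have hsplit : midU (rho d) (kB1 d :: kB2 d :: L') ρ₂ =
      pkMul (pkMul (pkScaleL (rho d) (kB1 d)) (kB2 d)) (pkScaleR (pkProdI L') ρ₂) := by
    rw [show kB1 d :: kB2 d :: L' = [kB1 d] ++ kB2 d :: L' from rfl, midU_append_cons, pkProdI_singleton]
  rw [hsplit]
  refine (pkHeadB_pkMul_le e _ _).trans (mul_le_mul' ?_ le_rfl)
  -- the head of `(ρB₁) B₂`: row mixture of `B₂`, then `H0`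
  have hH0 : ∀ y, pkHeadB e (pkScaleR (pkScaleL (rho d) (kB1 d)) (oRung d y)) ≤ 2 * d * percSqBar d := by
    intro y
    calc pkHeadB e (pkScaleR (pkScaleL (rho d) (kB1 d)) (oRung d y))
        ≤ 2 * d * pkHeadB e (pkScaleR (kRungL (kB1o d)) (oRung d y)) :=
          pkHeadB_le_of_le_const_mul e fun p q => by
            rw [pkScaleR_apply, pkScaleR_apply, ← mul_assoc]
            exact mul_le_mul' (pkScaleL_rho_kB1_le p q) le_rfl
      _ ≤ 2 * d * percSqBar d := by
          refine mul_le_mul' le_rfl ?_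
          cases e
          · exact pkHead2_rung_kB1o_oRung_le y
          · exact pkHead1_rung_kB1o_oRung_le y
  cases e
  · calc pkHead2 (pkMul (pkScaleL (rho d) (kB1 d)) (kB2 d))
        ≤ (percTriBar d + percTri d 0) * ⨆ y, pkHead2 (pkScaleR (pkScaleL (rho d) (kB1 d)) (oRung d y)) :=
          pkHead2_pkMul_kB2_le _
      _ ≤ (percTriBar d + percTri d 0) * (2 * d * percSqBar d) :=
          mul_le_mul' le_rfl (iSup_le fun y => hH0 y)
      _ = 2 * d * ((percTriBar d + percTri d 0) * percSqBar d) := by ring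
  · calc pkHead1 (pkMul (pkScaleL (rho d) (kB1 d)) (kB2 d))
        ≤ (percTriBar d + percTri d 0) * ⨆ y, pkHead1 (pkScaleR (pkScaleL (rho d) (kB1 d)) (oRung d y)) :=
          pkHead1_pkMul_kB2_le _
      _ ≤ (percTriBar d + percTri d 0) * (2 * d * percSqBar d) :=
          mul_le_mul' le_rfl (iSup_le fun y => hH0 y)
      _ = 2 * d * ((percTriBar d + percTri d 0) * percSqBar d) := by ring

/-- **Head of `ρ B₁ ρ'`** (the shortest middle factor with two rungs): `pkHeadB e (ρ·B₁·ρ) ≤ 2d S̄`.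
[cite: Hara2008, §3.5 (Case 2, (d-2))] -/
theorem pkHeadB_midU_rho_kB1_rho_le (e : Bool) :
    pkHeadB e (midU (rho d) [kB1 d] (rho d)) ≤ 2 * d * percSqBar d := by
  have h1 : midU (rho d) [kB1 d] (rho d) = pkScaleR (pkScaleL (rho d) (kB1 d)) (oRung d 0) := by
    rw [midU, pkProdI_singleton, oRung_zero_eq_rho]
  rw [h1]
  calc pkHeadB e (pkScaleR (pkScaleL (rho d) (kB1 d)) (oRung d 0))
      ≤ 2 * d * pkHeadB e (pkScaleR (kRungL (kB1o d)) (oRung d 0)) :=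
        pkHeadB_le_of_le_const_mul e fun p q => by
          rw [pkScaleR_apply, pkScaleR_apply, ← mul_assoc]
          exact mul_le_mul' (pkScaleL_rho_kB1_le p q) le_rfl
    _ ≤ 2 * d * percSqBar d := by
        refine mul_le_mul' le_rfl ?_
        cases e
        · exact pkHead2_rung_kB1o_oRung_le 0
        · exact pkHead1_rung_kB1o_oRung_le 0

/-- Splitting the first `B₂` of a middle factor: `midU ρ₁ (B₂ :: L) ρ₂ = midU ρ₁ (B₂⁽¹⁾ :: L) ρ₂ + midU ρ₁ (B₂⁽²⁾ :: L) ρ₂`.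
[cite: HeydenreichVanDerHofstad2017, (7.4.4)] -/
theorem midU_kB2_cons (ρ₁ : Site d × Site d → ℝ≥0∞) (L : List (Site d × Site d → Site d × Site d → ℝ≥0∞))
    (ρ₂ : Site d × Site d → ℝ≥0∞) (p q : Site d × Site d) :
    midU ρ₁ (kB2 d :: L) ρ₂ p q = midU ρ₁ (kB2one d :: L) ρ₂ p q + midU ρ₁ (kB2two d :: L) ρ₂ p q := by
  simp only [midU_apply, pkProdI_cons, kB2_eq_add, pkMul_add_left]
  ring

/-- Splitting the last `B₂` of a middle factor. [cite: HeydenreichVanDerHofstad2017, (7.4.4)] -/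
theorem midU_snoc_kB2 (ρ₁ : Site d × Site d → ℝ≥0∞) (L : List (Site d × Site d → Site d × Site d → ℝ≥0∞))
    (ρ₂ : Site d × Site d → ℝ≥0∞) (p q : Site d × Site d) :
    midU ρ₁ (L ++ [kB2 d]) ρ₂ p q = midU ρ₁ (L ++ [kB2one d]) ρ₂ p q + midU ρ₁ (L ++ [kB2two d]) ρ₂ p q := by
  simp only [midU_apply, pkProdI_append, pkProdI_singleton, kB2_eq_add, pkMul_add_right]
  ring

/-- **Head beginning with `B₂⁽¹⁾`**: `pkHeadB e (ρ₁·(B₂⁽¹⁾ Π L)·ρ₂) ≤ S̄ ‖(Π L)·ρ₂‖_{∞→∞}` for `ρ₁ ≤ 1`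
(`H1`: `B₂⁽¹⁾` alone closes). [cite: Hara2008, §3.5 (Case 2)] -/
theorem pkHeadB_midU_kB2one_le (e : Bool) {ρ₁ : Site d × Site d → ℝ≥0∞} (hρ₁ : ∀ p, ρ₁ p ≤ 1)
    (L : List (Site d × Site d → Site d × Site d → ℝ≥0∞)) (ρ₂ : Site d × Site d → ℝ≥0∞) :
    pkHeadB e (midU ρ₁ (kB2one d :: L) ρ₂) ≤ percSqBar d * pkNormInf (pkScaleR (pkProdI L) ρ₂) := by
  rw [midU_cons]
  refine (pkHeadB_pkMul_le e _ _).trans (mul_le_mul' ?_ le_rfl)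
  calc pkHeadB e (pkScaleL ρ₁ (kB2one d)) ≤ pkHeadB e (kB2one d) :=
        pkHeadB_mono e fun p q => by
          rw [pkScaleL_apply]; exact (mul_le_mul' (hρ₁ p) le_rfl).trans_eq (one_mul _)
    _ ≤ percSqBar d := by
        cases e
        · exact pkHead2_kB2one_le
        · exact pkHead1_kB2one_le

/-- **Head beginning with `B₂⁽²⁾ B₁ B₂`**: `pkHeadB e (ρ₁·(B₂⁽²⁾ B₁ B₂ Π L)·ρ₂) ≤
2d (Δ̄ + Δ(0)) Δ(0) S̄ ‖(Π L)·ρ₂‖_{∞→∞}` for `ρ₁ ≤ 1` (row mixture of the second `B₂`, then `Hs`).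
[cite: Hara2008, §3.5 (Case 2, Fig. 5 (d-3))] -/
theorem pkHeadB_midU_kB2two_kB1_kB2_le (e : Bool) {ρ₁ : Site d × Site d → ℝ≥0∞} (hρ₁ : ∀ p, ρ₁ p ≤ 1)
    (L : List (Site d × Site d → Site d × Site d → ℝ≥0∞)) (ρ₂ : Site d × Site d → ℝ≥0∞) :
    pkHeadB e (midU ρ₁ (kB2two d :: kB1 d :: kB2 d :: L) ρ₂) ≤
      2 * d * ((percTriBar d + percTri d 0) * (percTri d 0 * percSqBar d)) * pkNormInf (pkScaleR (pkProdI L) ρ₂) := by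
  have hsplit : midU ρ₁ (kB2two d :: kB1 d :: kB2 d :: L) ρ₂ =
      pkMul (pkMul (pkScaleL ρ₁ (pkProdI [kB2two d, kB1 d])) (kB2 d)) (pkScaleR (pkProdI L) ρ₂) := by
    rw [show kB2two d :: kB1 d :: kB2 d :: L = [kB2two d, kB1 d] ++ kB2 d :: L from rfl, midU_append_cons]
  rw [hsplit]
  refine (pkHeadB_pkMul_le e _ _).trans (mul_le_mul' ?_ le_rfl)
  have hP : pkProdI [kB2two d, kB1 d] = pkMul (kB2two d) (kB1 d) := by
    rw [pkProdI_cons, pkProdI_singleton]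
  -- drop `ρ₁ ≤ 1`, replace `B₁` by `2d B₁°`
  have hle : ∀ y p q, pkScaleR (pkScaleL ρ₁ (pkProdI [kB2two d, kB1 d])) (oRung d y) p q ≤
      2 * d * pkScaleR (pkMul (kB2two d) (kB1o d)) (oRung d y) p q := by
    intro y p q
    rw [pkScaleR_apply, pkScaleR_apply, pkScaleL_apply, hP, ← mul_assoc]
    refine mul_le_mul' ?_ le_rfl
    calc ρ₁ p * pkMul (kB2two d) (kB1 d) p q ≤ 1 * pkMul (kB2two d) (kB1 d) p q := mul_le_mul' (hρ₁ p) le_rfl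
      _ = pkMul (kB2two d) (kB1 d) p q := one_mul _
      _ ≤ _ := pkMul_kB2two_kB1_le p q
  have hHs : ∀ y, pkHeadB e (pkScaleR (pkScaleL ρ₁ (pkProdI [kB2two d, kB1 d])) (oRung d y)) ≤
      2 * d * (percTri d 0 * percSqBar d) := by
    intro y
    refine (pkHeadB_le_of_le_const_mul e (hle y)).trans (mul_le_mul' le_rfl ?_)
    cases e
    · exact pkHead2_kB2two_kB1o_oRung_le y
    · rw [pkHeadB_true, mul_comm]; exact pkHead1_kB2two_kB1o_oRung_le y
  cases e
  · calc pkHead2 (pkMul (pkScaleL ρ₁ (pkProdI [kB2two d, kB1 d])) (kB2 d))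
        ≤ (percTriBar d + percTri d 0) * ⨆ y, pkHead2 (pkScaleR (pkScaleL ρ₁ (pkProdI [kB2two d, kB1 d])) (oRung d y)) :=
          pkHead2_pkMul_kB2_le _
      _ ≤ (percTriBar d + percTri d 0) * (2 * d * (percTri d 0 * percSqBar d)) :=
          mul_le_mul' le_rfl (iSup_le fun y => hHs y)
      _ = _ := by ring
  · calc pkHead1 (pkMul (pkScaleL ρ₁ (pkProdI [kB2two d, kB1 d])) (kB2 d))
        ≤ (percTriBar d + percTri d 0) * ⨆ y, pkHead1 (pkScaleR (pkScaleL ρ₁ (pkProdI [kB2two d, kB1 d])) (oRung d y)) :=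
          pkHead1_pkMul_kB2_le _
      _ ≤ (percTriBar d + percTri d 0) * (2 * d * (percTri d 0 * percSqBar d)) :=
          mul_le_mul' le_rfl (iSup_le fun y => hHs y)
      _ = _ := by ring

/-- **Head `B₂⁽²⁾ B₁ ρ'`** (the star block, the next `B₁`, then a rung): `pkHeadB e (ρ₁·(B₂⁽²⁾B₁)·ρ) ≤ 2d Δ(0) S̄`
for `ρ₁ ≤ 1`. [cite: Hara2008, §3.5 (Case 2, Fig. 5 (d-3))] -/
theorem pkHeadB_midU_kB2two_kB1_rho_le (e : Bool) {ρ₁ : Site d × Site d → ℝ≥0∞} (hρ₁ : ∀ p, ρ₁ p ≤ 1) :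
    pkHeadB e (midU ρ₁ [kB2two d, kB1 d] (rho d)) ≤ 2 * d * (percTri d 0 * percSqBar d) := by
  have hP : pkProdI [kB2two d, kB1 d] = pkMul (kB2two d) (kB1 d) := by
    rw [pkProdI_cons, pkProdI_singleton]
  have hle : ∀ p q, midU ρ₁ [kB2two d, kB1 d] (rho d) p q ≤
      2 * d * pkScaleR (pkMul (kB2two d) (kB1o d)) (oRung d 0) p q := by
    intro p q
    rw [midU_apply, pkScaleR_apply, hP, ← mul_assoc, oRung_zero_eq_rho]
    refine mul_le_mul' ?_ le_rfl
    calc ρ₁ p * pkMul (kB2two d) (kB1 d) p q ≤ 1 * pkMul (kB2two d) (kB1 d) p q := mul_le_mul' (hρ₁ p) le_rfl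
      _ = pkMul (kB2two d) (kB1 d) p q := one_mul _
      _ ≤ _ := pkMul_kB2two_kB1_le p q
  refine (pkHeadB_le_of_le_const_mul e hle).trans (mul_le_mul' le_rfl ?_)
  cases e
  · exact pkHead2_kB2two_kB1o_oRung_le 0
  · rw [pkHeadB_true, mul_comm]; exact pkHead1_kB2two_kB1o_oRung_le 0

/-! ### Tails of the middle factor -/

/-- **Tail of `W B₂ B₁ ρ`** (families ending with `B₁` and a rung): `pkTailB e (ρ₁·(Π L' B₂ B₁)·ρ) ≤
‖ρ₁·Π L'‖_{1→1} 2d (Δ̄ + Δ(0)) S̄` (column mixture of `B₂`, then the square `T0`).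
[cite: Hara2008, §3.5 (Case 2, (d-2))] -/
theorem pkTailB_midU_kB2_kB1_rho_le (e : Bool) (ρ₁ : Site d × Site d → ℝ≥0∞)
    (L' : List (Site d × Site d → Site d × Site d → ℝ≥0∞)) :
    pkTailB e (midU ρ₁ (L' ++ [kB2 d, kB1 d]) (rho d)) ≤
      pkNormOne (pkScaleL ρ₁ (pkProdI L')) * (2 * d * ((percTriBar d + percTri d 0) * percSqBar d)) := by
  have hsplit : midU ρ₁ (L' ++ [kB2 d, kB1 d]) (rho d) =
      pkMul (pkScaleL ρ₁ (pkProdI L')) (pkMul (kB2 d) (pkScaleR (kB1 d) (rho d))) := by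
    rw [midU_append_cons, pkProdI_singleton, pkMul_assoc]
  rw [hsplit]
  refine (pkTailB_pkMul_le e _ _).trans (mul_le_mul' le_rfl ?_)
  have hT0 : ∀ y, pkTailB e (pkScaleL (oRung d y) (pkScaleR (kB1 d) (rho d))) ≤ 2 * d * percSqBar d := by
    intro y
    calc pkTailB e (pkScaleL (oRung d y) (pkScaleR (kB1 d) (rho d)))
        ≤ 2 * d * pkTailB e (pkScaleL (oRung d y) (kRungR (kB1o d))) :=
          pkTailB_le_of_le_const_mul e fun p q => by
            rw [pkScaleL_apply, pkScaleL_apply, mul_left_comm]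
            exact mul_le_mul' le_rfl (pkScaleR_kB1_rho_le p q)
      _ ≤ 2 * d * percSqBar d := by
          refine mul_le_mul' le_rfl ?_
          cases e
          · exact pkTail2_oRung_kB1o_rung_le y
          · exact pkTail1_oRung_kB1o_rung_le y
  cases e
  · calc pkTail2 (pkMul (kB2 d) (pkScaleR (kB1 d) (rho d)))
        ≤ (percTriBar d + percTri d 0) * ⨆ y, pkTail2 (pkScaleL (oRung d y) (pkScaleR (kB1 d) (rho d))) :=
          pkTail2_kB2_pkMul_le _
      _ ≤ (percTriBar d + percTri d 0) * (2 * d * percSqBar d) := mul_le_mul' le_rfl (iSup_le fun y => hT0 y)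
      _ = _ := by ring
  · calc pkTail1 (pkMul (kB2 d) (pkScaleR (kB1 d) (rho d)))
        ≤ (percTriBar d + percTri d 0) * ⨆ y, pkTail1 (pkScaleL (oRung d y) (pkScaleR (kB1 d) (rho d))) :=
          pkTail1_kB2_pkMul_le _
      _ ≤ (percTriBar d + percTri d 0) * (2 * d * percSqBar d) := mul_le_mul' le_rfl (iSup_le fun y => hT0 y)
      _ = _ := by ring

/-- **Tail of `ρ B₁ ρ'`**: `pkTailB e (ρ·B₁·ρ) ≤ 2d S̄`. [cite: Hara2008, §3.5 (Case 2, (d-2))] -/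
theorem pkTailB_midU_rho_kB1_rho_le (e : Bool) :
    pkTailB e (midU (rho d) [kB1 d] (rho d)) ≤ 2 * d * percSqBar d := by
  have h1 : midU (rho d) [kB1 d] (rho d) = pkScaleL (oRung d 0) (pkScaleR (kB1 d) (rho d)) := by
    rw [midU, pkProdI_singleton, oRung_zero_eq_rho]
    funext p q
    simp only [pkScaleR_apply, pkScaleL_apply, mul_assoc]
  rw [h1]
  calc pkTailB e (pkScaleL (oRung d 0) (pkScaleR (kB1 d) (rho d)))
      ≤ 2 * d * pkTailB e (pkScaleL (oRung d 0) (kRungR (kB1o d))) :=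
        pkTailB_le_of_le_const_mul e fun p q => by
          rw [pkScaleL_apply, pkScaleL_apply, mul_left_comm]
          exact mul_le_mul' le_rfl (pkScaleR_kB1_rho_le p q)
    _ ≤ 2 * d * percSqBar d := by
        refine mul_le_mul' le_rfl ?_
        cases e
        · exact pkTail2_oRung_kB1o_rung_le 0
        · exact pkTail1_oRung_kB1o_rung_le 0

/-- **Tail ending with `B₂⁽¹⁾`**: `pkTailB e (ρ₁·(Π L B₂⁽¹⁾)·ρ₂) ≤ ‖ρ₁·Π L‖_{1→1} S̄` for `ρ₂ ≤ 1` (`T1`).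
[cite: Hara2008, §3.5 (Case 2)] -/
theorem pkTailB_midU_snoc_kB2one_le (e : Bool) (ρ₁ : Site d × Site d → ℝ≥0∞)
    (L : List (Site d × Site d → Site d × Site d → ℝ≥0∞)) {ρ₂ : Site d × Site d → ℝ≥0∞} (hρ₂ : ∀ q, ρ₂ q ≤ 1) :
    pkTailB e (midU ρ₁ (L ++ [kB2one d]) ρ₂) ≤ pkNormOne (pkScaleL ρ₁ (pkProdI L)) * percSqBar d := by
  rw [midU_append_singleton]
  refine (pkTailB_pkMul_le e _ _).trans (mul_le_mul' le_rfl ?_)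
  calc pkTailB e (pkScaleR (kB2one d) ρ₂) ≤ pkTailB e (kB2one d) :=
        pkTailB_mono e fun p q => by
          rw [pkScaleR_apply]; exact (mul_le_mul' le_rfl (hρ₂ q)).trans_eq (mul_one _)
    _ ≤ percSqBar d := by
        cases e
        · exact pkTail2_kB2one_le
        · exact pkTail1_kB2one_le

/-- **Tail ending with `B₂ B₁ B₂⁽²⁾`**: `pkTailB e (ρ₁·(Π L B₂ B₁ B₂⁽²⁾)·ρ₂) ≤
‖ρ₁·Π L‖_{1→1} 2d (Δ̄ + Δ(0)) Δ(0) S̄` for `ρ₂ ≤ 1` (column mixture of the first `B₂`, then `Ts`).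
[cite: Hara2008, §3.5 (Case 2, Fig. 5 (d-3))] -/
theorem pkTailB_midU_kB2_kB1_kB2two_le (e : Bool) (ρ₁ : Site d × Site d → ℝ≥0∞)
    (L : List (Site d × Site d → Site d × Site d → ℝ≥0∞)) {ρ₂ : Site d × Site d → ℝ≥0∞} (hρ₂ : ∀ q, ρ₂ q ≤ 1) :
    pkTailB e (midU ρ₁ (L ++ [kB2 d, kB1 d, kB2two d]) ρ₂) ≤
      pkNormOne (pkScaleL ρ₁ (pkProdI L)) * (2 * d * ((percTriBar d + percTri d 0) * (percTri d 0 * percSqBar d))) := by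
  have hsplit : midU ρ₁ (L ++ [kB2 d, kB1 d, kB2two d]) ρ₂ =
      pkMul (pkScaleL ρ₁ (pkProdI L)) (pkMul (kB2 d) (pkScaleR (pkProdI [kB1 d, kB2two d]) ρ₂)) := by
    rw [midU_append_cons, pkMul_assoc]
  rw [hsplit]
  refine (pkTailB_pkMul_le e _ _).trans (mul_le_mul' le_rfl ?_)
  have hP : pkProdI [kB1 d, kB2two d] = pkMul (kB1 d) (kB2two d) := by rw [pkProdI_cons, pkProdI_singleton]
  have hle : ∀ y p q, pkScaleL (oRung d y) (pkScaleR (pkProdI [kB1 d, kB2two d]) ρ₂) p q ≤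
      2 * d * pkScaleL (oRung d y) (pkMul (kB1o d) (kB2two d)) p q := by
    intro y p q
    rw [pkScaleL_apply, pkScaleL_apply, pkScaleR_apply, hP]
    calc oRung d y p * (pkMul (kB1 d) (kB2two d) p q * ρ₂ q)
        ≤ oRung d y p * (pkMul (kB1 d) (kB2two d) p q * 1) := mul_le_mul' le_rfl (mul_le_mul' le_rfl (hρ₂ q))
      _ ≤ oRung d y p * (2 * d * pkMul (kB1o d) (kB2two d) p q) := by
          rw [mul_one]; exact mul_le_mul' le_rfl (pkMul_kB1_kB2two_le p q)
      _ = 2 * d * (oRung d y p * pkMul (kB1o d) (kB2two d) p q) := by ring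
  have hTs : ∀ y, pkTailB e (pkScaleL (oRung d y) (pkScaleR (pkProdI [kB1 d, kB2two d]) ρ₂)) ≤
      2 * d * (percTri d 0 * percSqBar d) := by
    intro y
    refine (pkTailB_le_of_le_const_mul e (hle y)).trans (mul_le_mul' le_rfl ?_)
    cases e
    · rw [pkTailB_false, mul_comm]; exact pkTail2_oRung_kB1o_kB2two_le y
    · exact pkTail1_oRung_kB1o_kB2two_le y
  cases e
  · calc pkTail2 (pkMul (kB2 d) (pkScaleR (pkProdI [kB1 d, kB2two d]) ρ₂))
        ≤ (percTriBar d + percTri d 0) * ⨆ y, pkTail2 (pkScaleL (oRung d y) (pkScaleR (pkProdI [kB1 d, kB2two d]) ρ₂)) :=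
          pkTail2_kB2_pkMul_le _
      _ ≤ (percTriBar d + percTri d 0) * (2 * d * (percTri d 0 * percSqBar d)) :=
          mul_le_mul' le_rfl (iSup_le fun y => hTs y)
      _ = _ := by ring
  · calc pkTail1 (pkMul (kB2 d) (pkScaleR (pkProdI [kB1 d, kB2two d]) ρ₂))
        ≤ (percTriBar d + percTri d 0) * ⨆ y, pkTail1 (pkScaleL (oRung d y) (pkScaleR (pkProdI [kB1 d, kB2two d]) ρ₂)) :=
          pkTail1_kB2_pkMul_le _
      _ ≤ (percTriBar d + percTri d 0) * (2 * d * (percTri d 0 * percSqBar d)) :=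
          mul_le_mul' le_rfl (iSup_le fun y => hTs y)
      _ = _ := by ring

/-- **Tail `ρ B₁ B₂⁽²⁾`**: `pkTailB e (ρ·(B₁B₂⁽²⁾)·ρ₂) ≤ 2d Δ(0) S̄` for `ρ₂ ≤ 1` (`Ts` with the entry rung).
[cite: Hara2008, §3.5 (Case 2, Fig. 5 (d-3))] -/
theorem pkTailB_midU_rho_kB1_kB2two_le (e : Bool) {ρ₂ : Site d × Site d → ℝ≥0∞} (hρ₂ : ∀ q, ρ₂ q ≤ 1) :
    pkTailB e (midU (rho d) [kB1 d, kB2two d] ρ₂) ≤ 2 * d * (percTri d 0 * percSqBar d) := by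
  have hP : pkProdI [kB1 d, kB2two d] = pkMul (kB1 d) (kB2two d) := by rw [pkProdI_cons, pkProdI_singleton]
  have hle : ∀ p q, midU (rho d) [kB1 d, kB2two d] ρ₂ p q ≤
      2 * d * pkScaleL (oRung d 0) (pkMul (kB1o d) (kB2two d)) p q := by
    intro p q
    rw [midU_apply, pkScaleL_apply, hP, oRung_zero_eq_rho]
    calc rho d p * pkMul (kB1 d) (kB2two d) p q * ρ₂ q
        ≤ rho d p * pkMul (kB1 d) (kB2two d) p q * 1 := mul_le_mul' le_rfl (hρ₂ q)
      _ ≤ rho d p * (2 * d * pkMul (kB1o d) (kB2two d) p q) := by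
          rw [mul_one]; exact mul_le_mul' le_rfl (pkMul_kB1_kB2two_le p q)
      _ = 2 * d * (rho d p * pkMul (kB1o d) (kB2two d) p q) := by ring
  refine (pkTailB_le_of_le_const_mul e hle).trans (mul_le_mul' le_rfl ?_)
  cases e
  · rw [pkTailB_false, mul_comm]; exact pkTail2_oRung_kB1o_kB2two_le 0
  · exact pkTail1_oRung_kB1o_kB2two_le 0

/-! ### The four families: heads and tails at the rate `κ` -/

/-- `2d (Δ̄ + Δ(0)) S̄ ≤ 𝕂⁴` (`d ≥ 1`). [folklore] -/
theorem junctionConst₁_le (hd : 1 ≤ d) : 2 * d * ((percTriBar d + percTri d 0) * percSqBar d) ≤ bigK d ^ 4 := by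
  have h1 : percTriBar d + percTri d 0 ≤ bigK d ^ 2 := by
    calc percTriBar d + percTri d 0 ≤ bigK d + bigK d := add_le_add (percTriBar_le_bigK hd) (percTri_le_bigK hd 0)
      _ = 2 * bigK d := (two_mul _).symm
      _ ≤ bigK d * bigK d := mul_le_mul' (two_le_bigK hd) le_rfl
      _ = bigK d ^ 2 := (sq _).symm
  calc 2 * d * ((percTriBar d + percTri d 0) * percSqBar d) ≤ bigK d * (bigK d ^ 2 * bigK d) :=
        mul_le_mul' two_mul_d_le_bigK (mul_le_mul' h1 (percSqBar_le_bigK hd))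
    _ = bigK d ^ 4 := by ring

/-- `2d (Δ̄ + Δ(0)) Δ(0) S̄ ≤ 𝕂⁵` (`d ≥ 1`). [folklore] -/
theorem junctionConst₂_le (hd : 1 ≤ d) :
    2 * d * ((percTriBar d + percTri d 0) * (percTri d 0 * percSqBar d)) ≤ bigK d ^ 5 := by
  have h1 : percTriBar d + percTri d 0 ≤ bigK d ^ 2 := by
    calc percTriBar d + percTri d 0 ≤ bigK d + bigK d := add_le_add (percTriBar_le_bigK hd) (percTri_le_bigK hd 0)
      _ = 2 * bigK d := (two_mul _).symm
      _ ≤ bigK d * bigK d := mul_le_mul' (two_le_bigK hd) le_rfl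
      _ = bigK d ^ 2 := (sq _).symm
  calc 2 * d * ((percTriBar d + percTri d 0) * (percTri d 0 * percSqBar d))
      ≤ bigK d * (bigK d ^ 2 * (bigK d * bigK d)) :=
        mul_le_mul' two_mul_d_le_bigK (mul_le_mul' h1 (mul_le_mul' (percTri_le_bigK hd 0) (percSqBar_le_bigK hd)))
    _ = bigK d ^ 5 := by ring

/-- `2d S̄ ≤ 𝕂²` (`d ≥ 1`). [folklore] -/
theorem two_d_percSqBar_le (hd : 1 ≤ d) : 2 * d * percSqBar d ≤ bigK d ^ 2 := by
  rw [sq]; exact mul_le_mul' two_mul_d_le_bigK (percSqBar_le_bigK hd)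

/-- `2d Δ(0) S̄ ≤ 𝕂³` (`d ≥ 1`). [folklore] -/
theorem two_d_percTri_percSqBar_le (hd : 1 ≤ d) : 2 * d * (percTri d 0 * percSqBar d) ≤ bigK d ^ 3 := by
  calc 2 * d * (percTri d 0 * percSqBar d) ≤ bigK d * (bigK d * bigK d) :=
        mul_le_mul' two_mul_d_le_bigK (mul_le_mul' (percTri_le_bigK hd 0) (percSqBar_le_bigK hd))
    _ = bigK d ^ 3 := by ring

/-- **Head, family `ρ B₁ (B₂B₁)^m ρ'`** (`m` units inside): `≤ 𝕂⁶ κ^{m-1}`. [cite: Hara2008, §3.5 (Case 2)] -/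
theorem head_fam_B1B1 (hd : 1 ≤ d) (e : Bool) (m : ℕ) :
    pkHeadB e (midU (rho d) (altL d true (2 * m + 1)) (rho d)) ≤ bigK d ^ 6 * kap d ^ (m - 1) := by
  rcases Nat.eq_zero_or_pos m with rfl | hm
  · -- `ρ B₁ ρ'`
    calc pkHeadB e (midU (rho d) (altL d true (2 * 0 + 1)) (rho d)) = pkHeadB e (midU (rho d) [kB1 d] (rho d)) := rfl
      _ ≤ 2 * d * percSqBar d := pkHeadB_midU_rho_kB1_rho_le e
      _ ≤ bigK d ^ 6 * kap d ^ (0 - 1) := by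
          rw [Nat.zero_sub, pow_zero, mul_one]
          exact le_bigK_pow_of_le hd (two_d_percSqBar_le hd) (by norm_num)
  · obtain ⟨k, rfl⟩ := Nat.exists_eq_add_of_le' hm
    -- `ρ B₁ B₂ · (altL true (2k+1)) · ρ'`
    have hL : altL d true (2 * (k + 1) + 1) = kB1 d :: kB2 d :: altL d true (2 * k + 1) := by
      rw [show 2 * (k + 1) + 1 = (2 * k + 1) + 1 + 1 by ring]; rfl
    rw [hL, Nat.add_sub_cancel]
    calc pkHeadB e (midU (rho d) (kB1 d :: kB2 d :: altL d true (2 * k + 1)) (rho d))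
        ≤ 2 * d * ((percTriBar d + percTri d 0) * percSqBar d) *
            pkNormInf (pkScaleR (pkProdI (altL d true (2 * k + 1))) (rho d)) := pkHeadB_midU_rho_kB1_kB2_le e _ _
      _ ≤ bigK d ^ 4 * (kap d ^ k * percTriTildeBar d) :=
          mul_le_mul' (junctionConst₁_le hd) (pkNormInf_altL_true_odd_rho_le k)
      _ ≤ bigK d ^ 4 * (kap d ^ k * bigK d ^ 2) :=
          mul_le_mul' le_rfl (mul_le_mul' le_rfl (le_bigK_pow_of_le_bigK hd percTriTildeBar_le_bigK (by norm_num)))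
      _ = bigK d ^ 6 * kap d ^ k := by ring

/-- **Head, family `ρ B₁B₂ (B₁B₂)^m`** (then a kernel erased on the right, `ρ₂ ≤ 1`): `≤ 𝕂⁴ κ^m`.
[cite: Hara2008, §3.5 (Case 2)] -/
theorem head_fam_B1B2 (hd : 1 ≤ d) (e : Bool) (m : ℕ) {ρ₂ : Site d × Site d → ℝ≥0∞} (hρ₂ : ∀ q, ρ₂ q ≤ 1) :
    pkHeadB e (midU (rho d) (altL d true (2 * m + 2)) ρ₂) ≤ bigK d ^ 4 * kap d ^ m := by
  have hL : altL d true (2 * m + 2) = kB1 d :: kB2 d :: altL d true (2 * m) := by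
    rw [show 2 * m + 2 = 2 * m + 1 + 1 by ring]; rfl
  rw [hL]
  calc pkHeadB e (midU (rho d) (kB1 d :: kB2 d :: altL d true (2 * m)) ρ₂)
      ≤ 2 * d * ((percTriBar d + percTri d 0) * percSqBar d) * pkNormInf (pkScaleR (pkProdI (altL d true (2 * m))) ρ₂) :=
        pkHeadB_midU_rho_kB1_kB2_le e _ _
    _ ≤ bigK d ^ 4 * kap d ^ m := mul_le_mul' (junctionConst₁_le hd) (pkNormInf_altL_true_even_pkScaleR_le m hρ₂)

/-- **Head, family `(B₂B₁)^{m+1} ρ'`** (`ρ₁ ≤ 1`, `κ ≤ 1`): `≤ 𝕂⁷ κ^{m-1}` (the `B₂⁽¹⁾`-part closes at once,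
the `B₂⁽²⁾`-part after the next unit). [cite: Hara2008, §3.5 (Case 2)] -/
theorem head_fam_B2B1 (hd : 1 ≤ d) (e : Bool) (m : ℕ) {ρ₁ : Site d × Site d → ℝ≥0∞} (hρ₁ : ∀ p, ρ₁ p ≤ 1)
    (hκ : kap d ≤ 1) :
    pkHeadB e (midU ρ₁ (altL d false (2 * m + 2)) (rho d)) ≤ bigK d ^ 7 * kap d ^ (m - 1) := by
  have hL : altL d false (2 * m + 2) = kB2 d :: altL d true (2 * m + 1) := by
    rw [show 2 * m + 2 = (2 * m + 1) + 1 by ring]; rfl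
  rw [hL]
  have hκm : kap d ^ m ≤ kap d ^ (m - 1) := pow_le_pow_of_le_one zero_le hκ (Nat.sub_le m 1)
  -- split `B₂ = B₂⁽¹⁾ + B₂⁽²⁾`
  have h1 : pkHeadB e (midU ρ₁ (kB2one d :: altL d true (2 * m + 1)) (rho d)) ≤ bigK d ^ 6 * kap d ^ (m - 1) := by
    calc pkHeadB e (midU ρ₁ (kB2one d :: altL d true (2 * m + 1)) (rho d))
        ≤ percSqBar d * pkNormInf (pkScaleR (pkProdI (altL d true (2 * m + 1))) (rho d)) :=
          pkHeadB_midU_kB2one_le e hρ₁ _ _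
      _ ≤ bigK d * (kap d ^ m * percTriTildeBar d) := mul_le_mul' (percSqBar_le_bigK hd) (pkNormInf_altL_true_odd_rho_le m)
      _ ≤ bigK d * (kap d ^ (m - 1) * bigK d ^ 5) :=
          mul_le_mul' le_rfl (mul_le_mul' hκm
            (le_bigK_pow_of_le_bigK hd percTriTildeBar_le_bigK (by norm_num)))
      _ = bigK d ^ 6 * kap d ^ (m - 1) := by ring
  have h2 : pkHeadB e (midU ρ₁ (kB2two d :: altL d true (2 * m + 1)) (rho d)) ≤ bigK d ^ 6 * kap d ^ (m - 1) := by
    rcases Nat.eq_zero_or_pos m with rfl | hm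
    · calc pkHeadB e (midU ρ₁ (kB2two d :: altL d true (2 * 0 + 1)) (rho d))
          = pkHeadB e (midU ρ₁ [kB2two d, kB1 d] (rho d)) := rfl
        _ ≤ 2 * d * (percTri d 0 * percSqBar d) := pkHeadB_midU_kB2two_kB1_rho_le e hρ₁
        _ ≤ bigK d ^ 6 * kap d ^ (0 - 1) := by
            rw [Nat.zero_sub, pow_zero, mul_one]
            exact le_bigK_pow_of_le hd (two_d_percTri_percSqBar_le hd) (by norm_num)
    · obtain ⟨k, rfl⟩ := Nat.exists_eq_add_of_le' hm
      have hL' : altL d true (2 * (k + 1) + 1) = kB1 d :: kB2 d :: altL d true (2 * k + 1) := by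
        rw [show 2 * (k + 1) + 1 = (2 * k + 1) + 1 + 1 by ring]; rfl
      rw [hL', Nat.add_sub_cancel]
      calc pkHeadB e (midU ρ₁ (kB2two d :: kB1 d :: kB2 d :: altL d true (2 * k + 1)) (rho d))
          ≤ 2 * d * ((percTriBar d + percTri d 0) * (percTri d 0 * percSqBar d)) *
              pkNormInf (pkScaleR (pkProdI (altL d true (2 * k + 1))) (rho d)) :=
            pkHeadB_midU_kB2two_kB1_kB2_le e hρ₁ _ _
        _ ≤ bigK d ^ 5 * (kap d ^ k * percTriTildeBar d) :=
            mul_le_mul' (junctionConst₂_le hd) (pkNormInf_altL_true_odd_rho_le k)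
        _ ≤ bigK d ^ 5 * (kap d ^ k * bigK d) := mul_le_mul' le_rfl (mul_le_mul' le_rfl percTriTildeBar_le_bigK)
        _ = bigK d ^ 6 * kap d ^ k := by ring
  calc pkHeadB e (midU ρ₁ (kB2 d :: altL d true (2 * m + 1)) (rho d))
      = pkHeadB e (fun p q => midU ρ₁ (kB2one d :: altL d true (2 * m + 1)) (rho d) p q +
          midU ρ₁ (kB2two d :: altL d true (2 * m + 1)) (rho d) p q) := by
        congr 1; funext p q; exact midU_kB2_cons ρ₁ _ _ p q
    _ ≤ bigK d ^ 6 * kap d ^ (m - 1) + bigK d ^ 6 * kap d ^ (m - 1) := (pkHeadB_add_le e _ _).trans (add_le_add h1 h2)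
    _ = 2 * (bigK d ^ 6 * kap d ^ (m - 1)) := (two_mul _).symm
    _ ≤ bigK d * (bigK d ^ 6 * kap d ^ (m - 1)) := mul_le_mul' (two_le_bigK hd) le_rfl
    _ = bigK d ^ 7 * kap d ^ (m - 1) := by ring

/-- **Head, family `B₂ (B₁B₂)^m`, `m ≥ 1`** (`ρ₁, ρ₂ ≤ 1`): `≤ 𝕂⁷ κ^{m-1}`. [cite: Hara2008, §3.5 (Case 2)] -/
theorem head_fam_B2B2 (hd : 1 ≤ d) (e : Bool) {m : ℕ} (hm : 1 ≤ m) {ρ₁ ρ₂ : Site d × Site d → ℝ≥0∞}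
    (hρ₁ : ∀ p, ρ₁ p ≤ 1) (hρ₂ : ∀ q, ρ₂ q ≤ 1) (hκ : kap d ≤ 1) :
    pkHeadB e (midU ρ₁ (altL d false (2 * m + 1)) ρ₂) ≤ bigK d ^ 7 * kap d ^ (m - 1) := by
  obtain ⟨k, rfl⟩ := Nat.exists_eq_add_of_le' hm
  rw [Nat.add_sub_cancel]
  have hL : altL d false (2 * (k + 1) + 1) = kB2 d :: kB1 d :: kB2 d :: altL d true (2 * k) := by
    rw [show 2 * (k + 1) + 1 = (2 * k) + 1 + 1 + 1 by ring]; rfl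
  rw [hL]
  have hκk : kap d ^ (k + 1) ≤ kap d ^ k := pow_le_pow_of_le_one zero_le hκ (Nat.le_succ k)
  have h1 : pkHeadB e (midU ρ₁ (kB2one d :: kB1 d :: kB2 d :: altL d true (2 * k)) ρ₂) ≤ bigK d ^ 6 * kap d ^ k := by
    have hL' : kB1 d :: kB2 d :: altL d true (2 * k) = altL d true (2 * (k + 1)) := by
      rw [show 2 * (k + 1) = 2 * k + 1 + 1 by ring]; rfl
    calc pkHeadB e (midU ρ₁ (kB2one d :: kB1 d :: kB2 d :: altL d true (2 * k)) ρ₂)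
        ≤ percSqBar d * pkNormInf (pkScaleR (pkProdI (kB1 d :: kB2 d :: altL d true (2 * k))) ρ₂) :=
          pkHeadB_midU_kB2one_le e hρ₁ _ _
      _ ≤ bigK d * kap d ^ (k + 1) := by
          rw [hL']; exact mul_le_mul' (percSqBar_le_bigK hd) (pkNormInf_altL_true_even_pkScaleR_le (k + 1) hρ₂)
      _ ≤ bigK d ^ 6 * kap d ^ k := mul_le_mul' (self_le_bigK_pow hd (by norm_num)) hκk
  have h2 : pkHeadB e (midU ρ₁ (kB2two d :: kB1 d :: kB2 d :: altL d true (2 * k)) ρ₂) ≤ bigK d ^ 6 * kap d ^ k := by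
    calc pkHeadB e (midU ρ₁ (kB2two d :: kB1 d :: kB2 d :: altL d true (2 * k)) ρ₂)
        ≤ 2 * d * ((percTriBar d + percTri d 0) * (percTri d 0 * percSqBar d)) *
            pkNormInf (pkScaleR (pkProdI (altL d true (2 * k))) ρ₂) := pkHeadB_midU_kB2two_kB1_kB2_le e hρ₁ _ _
      _ ≤ bigK d ^ 5 * kap d ^ k := mul_le_mul' (junctionConst₂_le hd) (pkNormInf_altL_true_even_pkScaleR_le k hρ₂)
      _ ≤ bigK d ^ 6 * kap d ^ k := mul_le_mul' (bigK_pow_mono hd (by norm_num)) le_rfl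
  calc pkHeadB e (midU ρ₁ (kB2 d :: kB1 d :: kB2 d :: altL d true (2 * k)) ρ₂)
      = pkHeadB e (fun p q => midU ρ₁ (kB2one d :: kB1 d :: kB2 d :: altL d true (2 * k)) ρ₂ p q +
          midU ρ₁ (kB2two d :: kB1 d :: kB2 d :: altL d true (2 * k)) ρ₂ p q) := by
        congr 1; funext p q; exact midU_kB2_cons ρ₁ _ _ p q
    _ ≤ bigK d ^ 6 * kap d ^ k + bigK d ^ 6 * kap d ^ k := (pkHeadB_add_le e _ _).trans (add_le_add h1 h2)
    _ = 2 * (bigK d ^ 6 * kap d ^ k) := (two_mul _).symm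
    _ ≤ bigK d * (bigK d ^ 6 * kap d ^ k) := mul_le_mul' (two_le_bigK hd) le_rfl
    _ = bigK d ^ 7 * kap d ^ k := by ring

/-- **Tail, family `ρ B₁ (B₂B₁)^m ρ'`**: `≤ 𝕂⁶ κ^{m-1}`. [cite: Hara2008, §3.5 (Case 2)] -/
theorem tail_fam_B1B1 (hd : 1 ≤ d) (e : Bool) (m : ℕ) :
    pkTailB e (midU (rho d) (altL d true (2 * m + 1)) (rho d)) ≤ bigK d ^ 6 * kap d ^ (m - 1) := by
  rcases Nat.eq_zero_or_pos m with rfl | hm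
  · calc pkTailB e (midU (rho d) (altL d true (2 * 0 + 1)) (rho d)) = pkTailB e (midU (rho d) [kB1 d] (rho d)) := rfl
      _ ≤ 2 * d * percSqBar d := pkTailB_midU_rho_kB1_rho_le e
      _ ≤ bigK d ^ 6 * kap d ^ (0 - 1) := by
          rw [Nat.zero_sub, pow_zero, mul_one]
          exact le_bigK_pow_of_le hd (two_d_percSqBar_le hd) (by norm_num)
  · obtain ⟨k, rfl⟩ := Nat.exists_eq_add_of_le' hm
    rw [Nat.add_sub_cancel, show 2 * (k + 1) + 1 = 2 * k + 3 by ring, altL_true_odd_snoc]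
    calc pkTailB e (midU (rho d) (altL d true (2 * k + 1) ++ [kB2 d, kB1 d]) (rho d))
        ≤ pkNormOne (pkScaleL (rho d) (pkProdI (altL d true (2 * k + 1)))) *
            (2 * d * ((percTriBar d + percTri d 0) * percSqBar d)) := pkTailB_midU_kB2_kB1_rho_le e _ _
      _ ≤ (percTriTildeBar d * kap d ^ k) * bigK d ^ 4 := mul_le_mul' (pkNormOne_rho_altL_true_odd_le k) (junctionConst₁_le hd)
      _ ≤ (bigK d ^ 2 * kap d ^ k) * bigK d ^ 4 :=
          mul_le_mul' (mul_le_mul' (le_bigK_pow_of_le_bigK hd percTriTildeBar_le_bigK (by norm_num)) le_rfl) le_rfl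
      _ = bigK d ^ 6 * kap d ^ k := by ring

/-- **Tail, family `ρ B₁B₂ (B₁B₂)^m`** (`ρ₂ ≤ 1`): `≤ 𝕂⁷ κ^{m-1}`. [cite: Hara2008, §3.5 (Case 2)] -/
theorem tail_fam_B1B2 (hd : 1 ≤ d) (e : Bool) (m : ℕ) {ρ₂ : Site d × Site d → ℝ≥0∞} (hρ₂ : ∀ q, ρ₂ q ≤ 1)
    (hκ : kap d ≤ 1) :
    pkTailB e (midU (rho d) (altL d true (2 * m + 2)) ρ₂) ≤ bigK d ^ 7 * kap d ^ (m - 1) := by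
  have hκm : kap d ^ m ≤ kap d ^ (m - 1) := pow_le_pow_of_le_one zero_le hκ (Nat.sub_le m 1)
  have hsnoc : altL d true (2 * m + 2) = altL d true (2 * m + 1) ++ [kB2 d] := altL_true_even_add_two m
  have h1 : pkTailB e (midU (rho d) (altL d true (2 * m + 1) ++ [kB2one d]) ρ₂) ≤ bigK d ^ 6 * kap d ^ (m - 1) := by
    calc pkTailB e (midU (rho d) (altL d true (2 * m + 1) ++ [kB2one d]) ρ₂)
        ≤ pkNormOne (pkScaleL (rho d) (pkProdI (altL d true (2 * m + 1)))) * percSqBar d :=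
          pkTailB_midU_snoc_kB2one_le e _ _ hρ₂
      _ ≤ (percTriTildeBar d * kap d ^ m) * bigK d := mul_le_mul' (pkNormOne_rho_altL_true_odd_le m) (percSqBar_le_bigK hd)
      _ ≤ (bigK d ^ 5 * kap d ^ (m - 1)) * bigK d :=
          mul_le_mul' (mul_le_mul' (le_bigK_pow_of_le_bigK hd percTriTildeBar_le_bigK (by norm_num)) hκm) le_rfl
      _ = bigK d ^ 6 * kap d ^ (m - 1) := by ring
  have h2 : pkTailB e (midU (rho d) (altL d true (2 * m + 1) ++ [kB2two d]) ρ₂) ≤ bigK d ^ 6 * kap d ^ (m - 1) := by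
    rcases Nat.eq_zero_or_pos m with rfl | hm
    · calc pkTailB e (midU (rho d) (altL d true (2 * 0 + 1) ++ [kB2two d]) ρ₂)
          = pkTailB e (midU (rho d) [kB1 d, kB2two d] ρ₂) := rfl
        _ ≤ 2 * d * (percTri d 0 * percSqBar d) := pkTailB_midU_rho_kB1_kB2two_le e hρ₂
        _ ≤ bigK d ^ 6 * kap d ^ (0 - 1) := by
            rw [Nat.zero_sub, pow_zero, mul_one]
            exact le_bigK_pow_of_le hd (two_d_percTri_percSqBar_le hd) (by norm_num)
    · obtain ⟨k, rfl⟩ := Nat.exists_eq_add_of_le' hm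
      rw [Nat.add_sub_cancel]
      have hL : altL d true (2 * (k + 1) + 1) ++ [kB2two d] = altL d true (2 * k + 1) ++ [kB2 d, kB1 d, kB2two d] := by
        rw [show 2 * (k + 1) + 1 = 2 * k + 3 by ring, altL_true_odd_snoc, List.append_assoc]; rfl
      rw [hL]
      calc pkTailB e (midU (rho d) (altL d true (2 * k + 1) ++ [kB2 d, kB1 d, kB2two d]) ρ₂)
          ≤ pkNormOne (pkScaleL (rho d) (pkProdI (altL d true (2 * k + 1)))) *
              (2 * d * ((percTriBar d + percTri d 0) * (percTri d 0 * percSqBar d))) :=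
            pkTailB_midU_kB2_kB1_kB2two_le e _ _ hρ₂
        _ ≤ (percTriTildeBar d * kap d ^ k) * bigK d ^ 5 := mul_le_mul' (pkNormOne_rho_altL_true_odd_le k) (junctionConst₂_le hd)
        _ ≤ (bigK d * kap d ^ k) * bigK d ^ 5 := mul_le_mul' (mul_le_mul' percTriTildeBar_le_bigK le_rfl) le_rfl
        _ = bigK d ^ 6 * kap d ^ k := by ring
  rw [hsnoc]
  calc pkTailB e (midU (rho d) (altL d true (2 * m + 1) ++ [kB2 d]) ρ₂)
      = pkTailB e (fun p q => midU (rho d) (altL d true (2 * m + 1) ++ [kB2one d]) ρ₂ p q +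
          midU (rho d) (altL d true (2 * m + 1) ++ [kB2two d]) ρ₂ p q) := by
        congr 1; funext p q; exact midU_snoc_kB2 _ _ _ p q
    _ ≤ bigK d ^ 6 * kap d ^ (m - 1) + bigK d ^ 6 * kap d ^ (m - 1) := (pkTailB_add_le e _ _).trans (add_le_add h1 h2)
    _ = 2 * (bigK d ^ 6 * kap d ^ (m - 1)) := (two_mul _).symm
    _ ≤ bigK d * (bigK d ^ 6 * kap d ^ (m - 1)) := mul_le_mul' (two_le_bigK hd) le_rfl
    _ = bigK d ^ 7 * kap d ^ (m - 1) := by ring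

/-- **Tail, family `(B₂B₁)^{m+1} ρ'`** (`ρ₁ ≤ 1`): `≤ 𝕂⁴ κ^m`. [cite: Hara2008, §3.5 (Case 2)] -/
theorem tail_fam_B2B1 (hd : 1 ≤ d) (e : Bool) (m : ℕ) {ρ₁ : Site d × Site d → ℝ≥0∞} (hρ₁ : ∀ p, ρ₁ p ≤ 1) :
    pkTailB e (midU ρ₁ (altL d false (2 * m + 2)) (rho d)) ≤ bigK d ^ 4 * kap d ^ m := by
  rw [altL_false_even_snoc]
  calc pkTailB e (midU ρ₁ (altL d false (2 * m) ++ [kB2 d, kB1 d]) (rho d))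
      ≤ pkNormOne (pkScaleL ρ₁ (pkProdI (altL d false (2 * m)))) * (2 * d * ((percTriBar d + percTri d 0) * percSqBar d)) :=
        pkTailB_midU_kB2_kB1_rho_le e _ _
    _ ≤ kap d ^ m * bigK d ^ 4 := mul_le_mul' (pkNormOne_pkScaleL_altL_false_even_le m hρ₁) (junctionConst₁_le hd)
    _ = bigK d ^ 4 * kap d ^ m := mul_comm _ _

/-- **Tail, family `B₂ (B₁B₂)^m`, `m ≥ 1`** (`ρ₁, ρ₂ ≤ 1`): `≤ 𝕂⁷ κ^{m-1}`. [cite: Hara2008, §3.5 (Case 2)] -/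
theorem tail_fam_B2B2 (hd : 1 ≤ d) (e : Bool) {m : ℕ} (hm : 1 ≤ m) {ρ₁ ρ₂ : Site d × Site d → ℝ≥0∞}
    (hρ₁ : ∀ p, ρ₁ p ≤ 1) (hρ₂ : ∀ q, ρ₂ q ≤ 1) (hκ : kap d ≤ 1) :
    pkTailB e (midU ρ₁ (altL d false (2 * m + 1)) ρ₂) ≤ bigK d ^ 7 * kap d ^ (m - 1) := by
  obtain ⟨k, rfl⟩ := Nat.exists_eq_add_of_le' hm
  rw [Nat.add_sub_cancel]
  have hκk : kap d ^ (k + 1) ≤ kap d ^ k := pow_le_pow_of_le_one zero_le hκ (Nat.le_succ k)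
  have h1 : pkTailB e (midU ρ₁ (altL d false (2 * (k + 1)) ++ [kB2one d]) ρ₂) ≤ bigK d ^ 6 * kap d ^ k := by
    calc pkTailB e (midU ρ₁ (altL d false (2 * (k + 1)) ++ [kB2one d]) ρ₂)
        ≤ pkNormOne (pkScaleL ρ₁ (pkProdI (altL d false (2 * (k + 1))))) * percSqBar d :=
          pkTailB_midU_snoc_kB2one_le e _ _ hρ₂
      _ ≤ kap d ^ (k + 1) * bigK d := mul_le_mul' (pkNormOne_pkScaleL_altL_false_even_le (k + 1) hρ₁) (percSqBar_le_bigK hd)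
      _ ≤ kap d ^ k * bigK d ^ 6 := mul_le_mul' hκk (self_le_bigK_pow hd (by norm_num))
      _ = bigK d ^ 6 * kap d ^ k := mul_comm _ _
  have h2 : pkTailB e (midU ρ₁ (altL d false (2 * (k + 1)) ++ [kB2two d]) ρ₂) ≤ bigK d ^ 6 * kap d ^ k := by
    have hL : altL d false (2 * (k + 1)) ++ [kB2two d] = altL d false (2 * k) ++ [kB2 d, kB1 d, kB2two d] := by
      rw [show 2 * (k + 1) = 2 * k + 2 by ring, altL_false_even_snoc, List.append_assoc]; rfl
    rw [hL]
    calc pkTailB e (midU ρ₁ (altL d false (2 * k) ++ [kB2 d, kB1 d, kB2two d]) ρ₂)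
        ≤ pkNormOne (pkScaleL ρ₁ (pkProdI (altL d false (2 * k)))) *
            (2 * d * ((percTriBar d + percTri d 0) * (percTri d 0 * percSqBar d))) :=
          pkTailB_midU_kB2_kB1_kB2two_le e _ _ hρ₂
      _ ≤ kap d ^ k * bigK d ^ 5 := mul_le_mul' (pkNormOne_pkScaleL_altL_false_even_le k hρ₁) (junctionConst₂_le hd)
      _ ≤ kap d ^ k * bigK d ^ 6 := mul_le_mul' le_rfl (bigK_pow_mono hd (by norm_num))
      _ = bigK d ^ 6 * kap d ^ k := mul_comm _ _
  have hsnoc : altL d false (2 * (k + 1) + 1) = altL d false (2 * (k + 1)) ++ [kB2 d] := altL_false_two_mul_add_one (k + 1)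
  rw [hsnoc]
  calc pkTailB e (midU ρ₁ (altL d false (2 * (k + 1)) ++ [kB2 d]) ρ₂)
      = pkTailB e (fun p q => midU ρ₁ (altL d false (2 * (k + 1)) ++ [kB2one d]) ρ₂ p q +
          midU ρ₁ (altL d false (2 * (k + 1)) ++ [kB2two d]) ρ₂ p q) := by
        congr 1; funext p q; exact midU_snoc_kB2 _ _ _ p q
    _ ≤ bigK d ^ 6 * kap d ^ k + bigK d ^ 6 * kap d ^ k := (pkTailB_add_le e _ _).trans (add_le_add h1 h2)
    _ = 2 * (bigK d ^ 6 * kap d ^ k) := (two_mul _).symm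
    _ ≤ bigK d * (bigK d ^ 6 * kap d ^ k) := mul_le_mul' (two_le_bigK hd) le_rfl
    _ = bigK d ^ 7 * kap d ^ k := by ring

end Literature.Barriers.CriticalPhenomena
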